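import Literature.Probability.RandomPlanarGeometry.SAWBridgeRenewalEquation
import Literature.Probability.RandomPlanarGeometry.SAWUnfoldingStep
import HarnessLib

/-!
# Duminil-Copin–Hammond 2013, §3: zigzags of a bridge and their unfolding (the definition layer of Proposition 3.2)

Topic `Literature/Probability/RandomPlanarGeometry` (continues `SAWBridges.lean` / `SAWSubBallistic.lean`:
the vertex-function model `saws d n` of `n`-step self-avoiding walks on `ℤ^d` from `0`, `bridges d n`
(Madras–Slade convention: height = first coordinate `ω k 0`, `y_0 < y_k ≤ y_n`), renewal times
`IsRenewalTime n ω r`). Source, read in the held arXiv text `paper:arxiv-1205.0401` (= CMP 324 (2013)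
401–423; locators `pNNNN:Lk` = chunk : line of that text; in the `[cite: …]` tags, `arXiv v1, p. N` is the
printed page of arXiv:1205.0401v1 (27 pp.) and equation numbers are the ones printed there):

H. Duminil-Copin, A. Hammond, *Self-avoiding walk is sub-ballistic*, Comm. Math. Phys. **324** (2013),
§3 "Positive density of renewal points at subexponential cost".

* Zigzags (p0008:L52–L59): "Let `γ ∈ SAB_n`. A zigzag of `γ` is a pair `(i,j)` of indices belonging to
  `{0,…,n}` that satisfy `i ≤ j` and for which the largest of the values `k` at which the maximum of
  `y(γ_k)` over `1 ≤ k ≤ j` is achieved equals `i`, and the largest of the values `k` at which the minimum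
  of `y(γ_k)` over `i ≤ k ≤ n` is achieved equals `j`. … the central section of `(i,j)` [is] `γ_{[i,j]}` …
  [of] length `j - i`. The indices `i` and `j` are respectively called the point of zig and the point of
  zag."
* **Lemma 3.3** (p0008:L63–L68): "(1) The central sections of the zigzags of `γ` are pairwise disjoint.
  (2) If `(i,i) ∈ Z`, then `γ_i ∈ R_γ`." ("readily verified", no printed proof.)
* **Definition 3.4** (p0008:L72–L73): "`Unf_{(i,j)}(γ) = γ_{[0,i]} ∘ σ_{γ_i}(γ_{[i,j]}) ∘ γ_{[j,n]}`", `σ_v`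
  the reflection in the hyperplane `{y = y(v)}`, `∘` the concatenation of §2.1.
* **Lemma 3.5** (p0008:L75–L82): "(1) `γ_i` and `Unf_{(i,j)}(γ)_j` each belong to `R_{Unf_{(i,j)}(γ)}`.
  (2) `Z(γ) ∖ {(i,j)} ⊆ Z(Unf_{(i,j)}(γ))`. (3) `Unf_{z₂} Unf_{z₁}(γ) = Unf_{z₁} Unf_{z₂}(γ)`."
  ("The proof … is straightforward and omitted.")
* **Definition 3.6** (p0008:L86–L87): "`Unf_Z(γ) ∈ SAB_n` [is] the bridge obtained by iteratively
  applying to `γ` the maps `Unf_z` for `z ∈ Z`."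
* **Lemma 3.7** (p0009:L3–L4): "`Unf_Z(γ) ∈ SAB_n` and `y(Unf_Z(γ)_n) ≥ y(γ_n)`." ("trivial")
* From the proof of Proposition 3.2: the level counts `V_{h,h+1}` (p0008:L20–L22) and the inclusion
  **(3.4)** `Unf_{Z_γ}(SAB^k_{u_n,v,δ}) ⊆ SAB^{k-1}_{u_n,v,δ}` (p0009:L30–L37); the renewal bound
  **(3.9)** `|R_φ| ≤ ε_n v_n + 3⌈1/δ'⌉δ''v_n` (p0010:L26–L35); the forward count **(3.8)**
  `|Unf(γ)| = binom(|shortZ_γ|, δ''v_n)` (p0010:L20–L23); the reconstruction "the data `γ` may be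
  reconstructed from `φ` provided that the pairs … are known" (p0010:L37–L44); Case 1 "if `γ_i ∈ R_γ` …
  then `|V_{h,h+1}| = 1` for `h = y(γ_i)`" (p0009:L22); "if `V_{h,h+1}` has only one element … the
  endpoint … belongs to `R_γ`" (p0008:L50).

## What this file provides (all definitions with bodies, all statements PROVED; no named facts)

This is the definition-and-bookkeeping layer of Proposition 3.2 (the lane «pcv-sawmu»'s item «ZIGZAG» of
the programme «DCH-1.1»: Theorem 1.1 of the source as a theorem); the entropy count of Cases 1–3 is
built on top of it elsewhere. Everything is typed over the tree's `saws`/`bridges`/`IsBridge`/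
`IsRenewalTime`; heights are first coordinates.

* `IsZigzag n ω i j`, `zigzags n ω` — the printed definition, as the four order clauses it means (with
  the printed range "`1 ≤ k ≤ j`", so `i ∈ [1, j]` when `j ≥ 1`; `(0,0)` and `(n,n)` are zigzags of every
  bridge); Lemma 3.3 (1) in the index form the proofs use (`IsZigzag.lt_of_lt`, `.zag_unique`,
  `.disjoint`, `fst_injOn_zigzags`, `card_zigzags_le`, `card_filter_long_zigzags_mul_le`: at most
  `n / L` zigzags have central length `≥ L`), Lemma 3.3 (2) (`IsZigzag.isRenewalTime_of_eq`).
* `unfoldZigzag i j ω` — Definition 3.4 with an EXPLICIT body (`zigzagHeight`: only the first coordinate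
  moves; `k ≤ i` unchanged, `i < k ≤ j` reflected to `2y_i - y_k`, `k > j` translated by `2(y_i - y_j)`),
  total in `(i, j, ω)`; `unfoldZigzag_mem_saws`/`_mem_bridges`, Lemma 3.7 (`le_zigzagHeight_last`),
  Lemma 3.5 (1) (`isRenewalTime_unfoldZigzag_zig/zag`), persistence of old renewal times
  (`IsRenewalTime.unfoldZigzag`), Lemma 3.5 (2) (`IsZigzag.unfoldZigzag`,
  `zigzags_erase_subset_zigzags_unfoldZigzag`), `unfoldZigzag_self` (`Unf_{(i,i)} = id`) and the
  involution `unfoldZigzag_unfoldZigzag` (the fold-back).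
* `renewalTimes n ω` (the finset `R_γ`; the lane's `renewalCount` is its cardinality) and the growth
  bound `card_renewalTimes_unfoldZigzag_le`: `|R(Unf_{(i,j)}γ)| ≤ |R(γ)| + 3(y_i - y_j) ≤ |R(γ)| + 3(j-i)`,
  with an honest count of the three height slabs where new renewal points can appear
  (`zigzagHeight_mem_Ico_of_new_renewal`).
* `unfoldZigzags Z ω` — Definition 3.6 as a closed form (`zigzagsShift`), PROVED equal to the iteration
  in either order (`unfoldZigzags_insert`, `unfoldZigzags_insert'`), whence Lemma 3.5 (3)
  (`unfoldZigzag_comm`) and the involution `unfoldZigzags_unfoldZigzags` (⇒ `unfoldZigzags_injective`: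
  `γ` is recovered from `(Unf_Z(γ), Z)`); the package `unfoldZigzags_spec` for `Z ⊆ Z(γ)`, `γ ∈ SAB_n`
  (bridge; Lemma 3.5 (2) iterated; renewal times persist; both ends of every pair are renewal times;
  `|R(Unf_Z γ)| ≤ |R(γ)| + 3 Σ (y_i - y_j)`), `le_unfoldZigzags_apply_last` (Lemma 3.7),
  `card_le_/two_mul_card_le_card_renewalTimes_unfoldZigzags` (display (3.7)),
  `card_renewalTimes_unfoldZigzags_le` (display (3.9): `≤ |R(γ)| + 3 Σ (j - i)`).
* `usedZigzags` and `unfoldZigzags_injOn` / `card_image_unfoldZigzags_powersetCard`: injectivity of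
  `Z ↦ Unf_Z(γ)` on subsets of the NON-DEGENERATE zigzags (display (3.8), repaired — see Δ1), and
  `card_degenerate_zigzags_le` (`#{(i,i)} ≤ |R_γ|`).
* `levelSteps n ω h` (the finset `V_{h,h+1}` of step-times; the lane's `levelVisits` is its cardinality),
  `levelSteps_eq_singleton_of_isRenewalTime` (Case 1), `exists_isRenewalTime_of_card_levelSteps_le_one`
  (end of the proof of Thm 3.1), and the two counts `card_sparse_levels_succ_le_card_renewalTimes`,
  `card_renewalTimes_le_card_sparse_levels_succ` (`|R_γ| = #{0 ≤ h < y_n : |V_{h,h+1}| ≤ 1} + 1`).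
* The level lemma behind (3.4): `levelShift`, `levelSteps_unfoldZigzags_eq_filter`,
  `card_levelSteps_unfoldZigzags_le`, `card_sparse_levels_le_card_sparse_levels_unfoldZigzags`
  (`#{h : |V_h(γ)| ≤ m} ≤ #{h' : |V_{h'}(Unf_{Z(γ)}γ)| ≤ max(1, m-2)}`) and the printed form
  `card_sparse_levels_le_card_sparse_levels_unfoldZigzags_pred` (`… ≤ k - 1`, `k ≥ 2`).
* The two reconstruction injections of the multi-valued map principle (appended): Case 2 —
  `injOn_zigzags_of_unfoldZigzags_eq`, `card_le_of_unfoldZigzags_all_eq` (pair-set code) and, via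
  `indexSet` / `eq_of_indexSet_eq` (a family of disjoint non-degenerate pairs is determined by its
  endpoint set) / `unfoldZigzags_filter_lt` (degenerate pairs are inert),
  `injOn_indexSet_of_unfoldZigzags_eq`, `card_le_of_unfoldZigzags_all_eq_indexSet` (index-set code,
  `#{I ⊆ [0,n] : |I| ≤ 2m}`, counted by `card_powerset_filter_card_le`); Case 3 — `shortPairsAt`,
  `card_shortPairsAt_le`, `subset_shortPairsAt_unfoldZigzags`, `card_le_choose_of_unfoldZigzags_eq`
  (fibre `≤ binom(|R_φ| · L, m)`; the printed `binom(|R_φ|, m) ⌈1/δ'⌉^m` has the same Lemma-3.8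
  quotient).

## As-printed deltas recorded (the statements used are proved as typed; the printed TEXT deviates)

* (Δ1) p0010:L20–L23 "the application … `Z ↦ Unf_Z(γ)` is one-to-one" is false as printed for sets
  containing a degenerate zigzag `(i,i)`: `Unf_{(i,i)} = id` (`unfoldZigzag_self`). It holds on subsets of
  non-degenerate zigzags (`unfoldZigzags_injOn`), and `#{degenerate} ≤ |R_γ|` (`card_degenerate_zigzags_le`),
  so in Case 3 (`|R_γ| ≤ ε_n v_n`) the forward count runs over `≥ (δ' - ε_n) v_n` short non-degenerate
  zigzags.
* (Δ2) p0010:L40–L41: given the point of zig, the point of zag of a short zigzag has `⌈1/δ'⌉ + 1` possible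
  values (`⌈1/δ'⌉` under the Δ1 convention `i < j`) — immaterial.
* (Δ3) p0009:L30–L37, the mechanism for (3.4) ("successive unfoldings leave `V_{h,h+1}` unchanged except
  for changing the value of `h` … drops by at least two") is not a function of `h` (one unfolding splits
  the edge set of a level over three levels); (3.4) itself is proved here by the explicit strictly
  increasing injection `h ↦ h + levelShift h` (`levelSteps_unfoldZigzags_eq_filter`).
* (Δ4) The zigzag clause "over `1 ≤ k ≤ j`" (not `0 ≤ k`) is typed as printed; for the tree's bridges
  (`y_0 < y_k`) the two readings agree.
* (Δ5) Case 1 (p0009:L22–L23) counts `|R_γ|` levels with `|V| = 1`, but the top renewal time `n` has no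
  level below `y_n`: the exact relation is `|R_γ| = #{h < y_n : |V_{h,h+1}| = 1} + 1`
  (`card_renewalTimes_le_card_sparse_levels_succ`) — immaterial (`δ' ↦ δ'/2`).
* (Δ6) p0009:L40–L47 (Case 2 preimage `≤ binom(u_n, 2ε_n u_n)`): "the union of the points … of zig and
  of zag" determines the unfolded family only for NON-degenerate pairs (consecutive pairing of the
  endpoint set, `eq_of_indexSet_eq`); degenerate zigzags are inert under `Unf` (`unfoldZigzags_filter_lt`),
  so the count is run over the non-degenerate zigzags (`card_le_of_unfoldZigzags_all_eq_indexSet`).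

## References

* H. Duminil-Copin, A. Hammond, *Self-avoiding walk is sub-ballistic*, Comm. Math. Phys. 324 (2013)
  401–423, doi:10.1007/s00220-013-1811-1, arXiv:1205.0401 — §3: zigzags, Lemma 3.3, Def. 3.4, Lemma 3.5,
  Def. 3.6, Lemma 3.7, proof of Prop. 3.2 ((3.3)–(3.10)), proof of Thm 3.1; pages/equations as in arXiv v1. [DuminilCopinHammond2013]
* N. Madras, G. Slade, *The Self-Avoiding Walk*, Birkhäuser (1993), Def. 1.2.4 (bridges), §3.1
  (unfolding). [MadrasSlade1993]
-/

noncomputable section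

open Finset Function Literature.Probability.LatticeModels Literature.Probability.Percolation SimpleGraph
open scoped BigOperators

namespace Literature.Probability.RandomPlanarGeometry.SAW.Zd

variable {d : ℕ} [NeZero d]

/-! ### Height bookkeeping: sites with a modified first coordinate -/

/-- Two sites with the same coordinates except possibly the first, whose first coordinates differ by
the same amount up to sign as two adjacent sites, are adjacent. [cite: MadrasSlade1993, §3.1 (proof of Proposition 3.1.5: only the first coordinate is reflected)] -/
theorem zdGraph_adj_update_zero {x y : Site d} (h : (zdGraph d).Adj x y) {a b : ℤ}
    (hab : b - a = y 0 - x 0 ∨ b - a = x 0 - y 0) :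
    (zdGraph d).Adj (Function.update x 0 a) (Function.update y 0 b) := by
  rw [zdGraph_adj_iff_sub] at h ⊢
  obtain ⟨i, hi⟩ := h
  refine ⟨i, ?_⟩
  have key : ∀ {p q : Site d} {a b : ℤ}, q - p = Pi.single i 1 →
      (b - a = q 0 - p 0 ∨ b - a = p 0 - q 0) →
      Function.update q 0 b - Function.update p 0 a = Pi.single i 1 ∨
        Function.update p 0 a - Function.update q 0 b = Pi.single i 1 := by
    intro p q a b hpq hab
    have hj : ∀ j : Fin d, q j - p j = if j = i then 1 else 0 := fun j => by
      have := congrFun hpq j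
      simpa [Pi.single_apply] using this
    by_cases hi0 : i = 0
    · subst hi0
      have h0 := hj 0
      rw [if_pos rfl] at h0
      have hab' : b - a = 1 ∨ a - b = 1 := by rcases hab with hab | hab <;> omega
      rcases hab' with hab' | hab'
      · left
        funext j
        by_cases hj0 : j = 0
        · subst hj0; simpa [Pi.single_apply] using hab'
        · have := hj j
          rw [if_neg hj0] at this
          simp [hj0, this]
      · right
        funext j
        by_cases hj0 : j = 0
        · subst hj0; simpa [Pi.single_apply] using hab'
        · have := hj j
          rw [if_neg hj0] at this
          simp [hj0]
          omega
    · left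
      have h0 := hj 0
      rw [if_neg (Ne.symm hi0)] at h0
      have hba : b - a = 0 := by rcases hab with hab | hab <;> omega
      funext j
      by_cases hj0 : j = 0
      · subst hj0
        simp [Ne.symm hi0]
        omega
      · have := hj j
        simp [Pi.single_apply, hj0]
        by_cases hji : j = i
        · subst hji; simpa using this
        · rw [if_neg hji] at this; simpa [hji] using this
  rcases hi with hi | hi
  · exact key hi hab
  · rcases key (a := b) (b := a) hi (by rcases hab with hab | hab <;> omega) with h1 | h1
    · exact Or.inr h1
    · exact Or.inl h1

/-- A site is determined by its first coordinate and the others. [cite: MadrasSlade1993, §3.1 (proof of Proposition 3.1.5: only the first coordinate is reflected)] -/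
theorem eq_of_update_zero_eq {x y : Site d} {a b : ℤ}
    (h : Function.update x 0 a = Function.update y 0 b) (h0 : x 0 = y 0) : x = y := by
  funext j
  by_cases hj : j = 0
  · subst hj; exact h0
  · have := congrFun h j
    simpa [hj] using this

/-- Equal updated sites have equal new first coordinates. [cite: MadrasSlade1993, §3.1 (proof of Proposition 3.1.5: only the first coordinate is reflected)] -/
theorem apply_eq_of_update_zero_eq {x y : Site d} {a b : ℤ}
    (h : Function.update x 0 a = Function.update y 0 b) : a = b := by
  have := congrFun h 0
  simpa using this

/-- Along a nearest-neighbour walk the first coordinate is `1`-Lipschitz in time. [cite: MadrasSlade1993, §1.1 (nearest-neighbour walks)] -/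
theorem abs_apply_zero_sub_le {ω : ℕ → Site d} {n : ℕ}
    (hadj : ∀ i < n, (zdGraph d).Adj (ω i) (ω (i + 1))) {k l : ℕ} (hkl : k ≤ l) (hl : l ≤ n) :
    |ω l 0 - ω k 0| ≤ (l : ℤ) - k := by
  induction l with
  | zero =>
    have : k = 0 := by omega
    subst this; simp
  | succ l ih =>
    rcases hkl.eq_or_lt with rfl | hlt
    · simp
    · have h1 := abs_sub_le_one_of_adj (hadj l (by omega)) 0
      have h2 := ih (by omega) (by omega)
      calc |ω (l + 1) 0 - ω k 0| = |(ω (l + 1) 0 - ω l 0) + (ω l 0 - ω k 0)| := by ring_nf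
        _ ≤ |ω (l + 1) 0 - ω l 0| + |ω l 0 - ω k 0| := abs_add_le _ _
        _ ≤ ((l + 1 : ℕ) : ℤ) - k := by push_cast; linarith

/-! ### Renewal times of a bridge, read on the heights -/

/-- For a bridge, `r ≤ n` is a renewal time iff every earlier height is `≤` the height at `r` and
every later height is `>` it. [cite: DuminilCopinHammond2013, §2.2] -/
theorem isRenewalTime_iff_heights {n : ℕ} {ω : ℕ → Site d} (hω : IsBridge n ω) {r : ℕ} (hr : r ≤ n) :
    IsRenewalTime n ω r ↔
      (∀ k, k ≤ r → ω k 0 ≤ ω r 0) ∧ (∀ k, r < k → k ≤ n → ω r 0 < ω k 0) := by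
  constructor
  · rintro ⟨-, h1, h2⟩
    refine ⟨fun k hk => ?_, fun k hk hkn => ?_⟩
    · rcases Nat.eq_zero_or_pos k with rfl | hk0
      · rcases Nat.eq_zero_or_pos r with rfl | hr0
        · exact le_rfl
        · exact (hω r hr0 hr).1.le
      · exact (h1 k hk0 hk).2
    · have := (h2 (k - r) (by omega) (by omega)).1
      simpa [Nat.add_sub_cancel' hk.le] using this
  · rintro ⟨h1, h2⟩
    refine ⟨hr, fun i hi1 hi2 => ⟨(hω i hi1 (hi2.trans hr)).1, h1 i hi2⟩, fun m hm1 hm2 => ⟨?_, ?_⟩⟩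
    · simpa using h2 (r + m) (by omega) (by omega)
    · have := (hω (r + m) (by omega) (by omega)).2
      simpa [Nat.add_sub_cancel' hr] using this

/-- Renewal times of a bridge have strictly increasing heights. [cite: DuminilCopinHammond2013, §2.2] -/
theorem apply_lt_apply_of_isRenewalTime {n : ℕ} {ω : ℕ → Site d} (hω : IsBridge n ω) {r s : ℕ}
    (hr : IsRenewalTime n ω r) (hs : IsRenewalTime n ω s) (hrs : r < s) : ω r 0 < ω s 0 :=
  ((isRenewalTime_iff_heights hω hr.1).1 hr).2 s hrs hs.1

/-! ### Zigzags (Duminil-Copin–Hammond 2013, §3, before Lemma 3.3) -/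

/-- **Zigzag** of an `n`-step walk `ω` (a bridge, in every use): a pair of times `i ≤ j ≤ n` such that
"the largest of the values `k` at which the maximum of `y(γ_k)` over `1 ≤ k ≤ j` is achieved equals
`i`, and the largest of the values `k` at which the minimum of `y(γ_k)` over `i ≤ k ≤ n` is achieved
equals `j`" (height `y` = first coordinate, the tree's bridge direction). Typed by the four order
clauses this phrase means, plus `i ∈ [1, j]` when that range is non-empty; `i` is the *point of zig*,
`j` the *point of zag*, `γ[i, j]` the *central section*, of length `j - i`.
[cite: DuminilCopinHammond2013, §3 (definition of a zigzag, before Lemma 3.3; arXiv v1, p. 12)] -/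
def IsZigzag (n : ℕ) (ω : ℕ → Site d) (i j : ℕ) : Prop :=
  i ≤ j ∧ j ≤ n ∧ (1 ≤ j → 1 ≤ i) ∧
    (∀ k, 1 ≤ k → k ≤ j → ω k 0 ≤ ω i 0) ∧ (∀ k, i < k → k ≤ j → ω k 0 < ω i 0) ∧
    (∀ k, i ≤ k → k ≤ n → ω j 0 ≤ ω k 0) ∧ (∀ k, j < k → k ≤ n → ω j 0 < ω k 0)

open Classical in
/-- `Z(γ)`, the finite set of zigzags of the `n`-step walk `ω`, as pairs `(i, j)` (point of zig, point
of zag). [cite: DuminilCopinHammond2013, §3 (arXiv v1, p. 12)] -/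
def zigzags (n : ℕ) (ω : ℕ → Site d) : Finset (ℕ × ℕ) :=
  ((range (n + 1)) ×ˢ (range (n + 1))).filter fun z => IsZigzag n ω z.1 z.2

/-- Membership in `zigzags`. [cite: DuminilCopinHammond2013, §3] -/
theorem mem_zigzags {n : ℕ} {ω : ℕ → Site d} {z : ℕ × ℕ} :
    z ∈ zigzags n ω ↔ IsZigzag n ω z.1 z.2 := by
  classical
  rw [zigzags, mem_filter, mem_product, mem_range, mem_range]
  exact ⟨fun h => h.2, fun h => ⟨⟨by have := h.1; have := h.2.1; omega, by have := h.2.1; omega⟩, h⟩⟩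

/-- Membership in `zigzags`, pair form. [cite: DuminilCopinHammond2013, §3] -/
theorem mk_mem_zigzags {n : ℕ} {ω : ℕ → Site d} {i j : ℕ} :
    (i, j) ∈ zigzags n ω ↔ IsZigzag n ω i j := mem_zigzags

namespace IsZigzag

variable {n : ℕ} {ω : ℕ → Site d} {i j : ℕ}

/-- `i ≤ j`. [cite: DuminilCopinHammond2013, §3 (zigzags, arXiv v1, p. 12)] -/
theorem le (h : IsZigzag n ω i j) : i ≤ j := h.1
/-- `j ≤ n`. [cite: DuminilCopinHammond2013, §3 (zigzags, arXiv v1, p. 12)] -/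
theorem le_n (h : IsZigzag n ω i j) : j ≤ n := h.2.1
/-- `i ≤ n`. [cite: DuminilCopinHammond2013, §3 (zigzags, arXiv v1, p. 12)] -/
theorem fst_le_n (h : IsZigzag n ω i j) : i ≤ n := h.1.trans h.2.1
/-- The point of zig lies in `[1, j]` when that range is non-empty. [cite: DuminilCopinHammond2013, §3 (zigzags, arXiv v1, p. 12)] -/
theorem one_le (h : IsZigzag n ω i j) (hj : 1 ≤ j) : 1 ≤ i := h.2.2.1 hj
/-- Heights on `[1, j]` are at most the height at the point of zig. [cite: DuminilCopinHammond2013, §3 (zigzags, arXiv v1, p. 12)] -/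
theorem apply_le_zig (h : IsZigzag n ω i j) {k : ℕ} (h1 : 1 ≤ k) (h2 : k ≤ j) : ω k 0 ≤ ω i 0 :=
  h.2.2.2.1 k h1 h2
/-- Heights on `(i, j]` are strictly below the height at the point of zig. [cite: DuminilCopinHammond2013, §3 (zigzags, arXiv v1, p. 12)] -/
theorem apply_lt_zig (h : IsZigzag n ω i j) {k : ℕ} (h1 : i < k) (h2 : k ≤ j) : ω k 0 < ω i 0 :=
  h.2.2.2.2.1 k h1 h2
/-- Heights on `[i, n]` are at least the height at the point of zag. [cite: DuminilCopinHammond2013, §3 (zigzags, arXiv v1, p. 12)] -/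
theorem zag_le_apply (h : IsZigzag n ω i j) {k : ℕ} (h1 : i ≤ k) (h2 : k ≤ n) : ω j 0 ≤ ω k 0 :=
  h.2.2.2.2.2.1 k h1 h2
/-- Heights on `(j, n]` are strictly above the height at the point of zag. [cite: DuminilCopinHammond2013, §3 (zigzags, arXiv v1, p. 12)] -/
theorem zag_lt_apply (h : IsZigzag n ω i j) {k : ℕ} (h1 : j < k) (h2 : k ≤ n) : ω j 0 < ω k 0 :=
  h.2.2.2.2.2.2 k h1 h2
/-- The point of zag is not higher than the point of zig. [cite: DuminilCopinHammond2013, §3 (zigzags, arXiv v1, p. 12)] -/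
theorem zag_le_zig (h : IsZigzag n ω i j) : ω j 0 ≤ ω i 0 := h.zag_le_apply le_rfl h.fst_le_n
/-- For a bridge, every height up to time `i` is at most the height at the point of zig.
[cite: DuminilCopinHammond2013, §3 (zigzags, arXiv v1, p. 12)] -/
theorem apply_le_zig_of_le (h : IsZigzag n ω i j) (hω : IsBridge n ω) {k : ℕ} (hk : k ≤ i) :
    ω k 0 ≤ ω i 0 := by
  rcases Nat.eq_zero_or_pos k with rfl | hk0
  · rcases Nat.eq_zero_or_pos i with rfl | hi0
    · exact le_rfl
    · exact (hω i hi0 h.fst_le_n).1.le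
  · exact h.apply_le_zig hk0 (hk.trans h.le)
/-- A zigzag with a non-trivial central section strictly descends: `y_j < y_i`. [cite: DuminilCopinHammond2013, §3 (zigzags, arXiv v1, p. 12)] -/
theorem zag_lt_zig (h : IsZigzag n ω i j) (hij : i < j) : ω j 0 < ω i 0 := h.apply_lt_zig hij le_rfl
/-- The height drop of the central section is at most its length. [cite: DuminilCopinHammond2013, §3 (zigzags, arXiv v1, p. 12)] -/
theorem zig_sub_zag_le (h : IsZigzag n ω i j) (hadj : ∀ k < n, (zdGraph d).Adj (ω k) (ω (k + 1))) :
    ω i 0 - ω j 0 ≤ (j : ℤ) - i := by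
  have := abs_apply_zero_sub_le hadj h.le h.le_n
  rw [abs_sub_comm] at this
  exact (le_abs_self _).trans this

end IsZigzag

/-- **Lemma 3.3 (1)**, index form: two zigzags with distinct points of zig have disjoint index
intervals — if `i < i'` then `j < i'`. (The printed "the central sections of the zigzags of `γ` are
pairwise disjoint"; for a self-avoiding `γ` the two forms are equivalent, and this is the one the
proofs use.) [cite: DuminilCopinHammond2013, Lemma 3.3 (1) (arXiv v1, p. 12)] -/
theorem IsZigzag.lt_of_lt {n : ℕ} {ω : ℕ → Site d} {i j i' j' : ℕ} (h : IsZigzag n ω i j)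
    (h' : IsZigzag n ω i' j') (hii' : i < i') : j < i' := by
  by_contra hle
  rw [not_lt] at hle
  have h1 : 1 ≤ i := h.one_le (by omega)
  have hA : ω i 0 ≤ ω i' 0 := h'.apply_le_zig h1 (by have := h'.le; omega)
  have hB : ω i' 0 < ω i 0 := h.apply_lt_zig hii' hle
  exact absurd hA (not_le.2 hB)

/-- **Lemma 3.3 (1)**, functional form: the point of zag is determined by the point of zig.
[cite: DuminilCopinHammond2013, Lemma 3.3 (1) (arXiv v1, p. 12)] -/
theorem IsZigzag.zag_unique {n : ℕ} {ω : ℕ → Site d} {i j j' : ℕ} (h : IsZigzag n ω i j)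
    (h' : IsZigzag n ω i j') : j = j' := by
  by_contra hne
  rcases lt_or_gt_of_ne hne with hlt | hlt
  · exact absurd (h'.zag_le_apply h.le h.le_n) (not_le.2 (h.zag_lt_apply hlt h'.le_n))
  · exact absurd (h.zag_le_apply h'.le h'.le_n) (not_le.2 (h'.zag_lt_apply hlt h.le_n))

/-- **Lemma 3.3 (1)**: two distinct zigzags have disjoint (and comparable) index intervals.
[cite: DuminilCopinHammond2013, Lemma 3.3 (1) (arXiv v1, p. 12)] -/
theorem IsZigzag.disjoint {n : ℕ} {ω : ℕ → Site d} {i j i' j' : ℕ} (h : IsZigzag n ω i j)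
    (h' : IsZigzag n ω i' j') (hne : (i, j) ≠ (i', j')) : j < i' ∨ j' < i := by
  rcases lt_trichotomy i i' with hlt | heq | hgt
  · exact Or.inl (h.lt_of_lt h' hlt)
  · subst heq
    exact absurd (show (i, j) = (i, j') by rw [h.zag_unique h']) hne
  · exact Or.inr (h'.lt_of_lt h hgt)

/-- The point of zig determines the zigzag: `Prod.fst` is injective on `zigzags n ω`.
[cite: DuminilCopinHammond2013, Lemma 3.3 (1)] -/
theorem fst_injOn_zigzags (n : ℕ) (ω : ℕ → Site d) : Set.InjOn Prod.fst (zigzags n ω : Set (ℕ × ℕ)) := by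
  intro z hz z' hz' h
  have h1 := mem_zigzags.1 (Finset.mem_coe.1 hz)
  have h2 := mem_zigzags.1 (Finset.mem_coe.1 hz')
  refine Prod.ext h ?_
  rw [← h] at h2
  exact h1.zag_unique h2

/-- There are at most `n + 1` zigzags. [cite: DuminilCopinHammond2013, Lemma 3.3 (1)] -/
theorem card_zigzags_le (n : ℕ) (ω : ℕ → Site d) : #(zigzags n ω) ≤ n + 1 := by
  calc #(zigzags n ω) = #((zigzags n ω).image Prod.fst) :=
        (card_image_of_injOn (fst_injOn_zigzags n ω)).symm
    _ ≤ #(range (n + 1)) := card_le_card fun i hi => by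
        obtain ⟨z, hz, rfl⟩ := mem_image.1 hi
        exact mem_range.2 (Nat.lt_succ_of_le (mem_zigzags.1 hz).fst_le_n)
    _ = n + 1 := card_range _

/-- **Lemma 3.3 (2)**: a degenerate zigzag `(i, i)` of a bridge sits at a renewal time.
[cite: DuminilCopinHammond2013, Lemma 3.3 (2) (arXiv v1, p. 12)] -/
theorem IsZigzag.isRenewalTime_of_eq {n : ℕ} {ω : ℕ → Site d} {i : ℕ} (h : IsZigzag n ω i i)
    (hω : IsBridge n ω) : IsRenewalTime n ω i := by
  rw [isRenewalTime_iff_heights hω h.le_n]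
  exact ⟨fun k hk => h.apply_le_zig_of_le hω hk, fun k hk hkn => h.zag_lt_apply hk hkn⟩

/-- `(n, n)` is a zigzag of every bridge. [cite: DuminilCopinHammond2013, §3] -/
theorem isZigzag_last {n : ℕ} {ω : ℕ → Site d} (hω : IsBridge n ω) : IsZigzag n ω n n := by
  refine ⟨le_rfl, le_rfl, id, fun k h1 h2 => (hω k h1 h2).2, fun k h1 h2 => absurd h2 (not_le.2 h1),
    fun k h1 h2 => ?_, fun k h1 h2 => absurd h2 (not_le.2 h1)⟩
  rw [le_antisymm h2 h1]

/-- `(0, 0)` is a zigzag of every bridge (the printed range `1 ≤ k ≤ 0` being empty).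
[cite: DuminilCopinHammond2013, §3] -/
theorem isZigzag_zero {n : ℕ} {ω : ℕ → Site d} (hω : IsBridge n ω) : IsZigzag n ω 0 0 := by
  refine ⟨le_rfl, Nat.zero_le _, fun h => absurd h (by norm_num), fun k h1 h2 => by omega,
    fun k h1 h2 => by omega, fun k _ h2 => ?_, fun k h1 h2 => (hω k h1 h2).1⟩
  rcases Nat.eq_zero_or_pos k with rfl | hk
  · exact le_rfl
  · exact (hω k hk h2).1.le

/-- Disjoint central sections: the zigzags whose central section has length `≥ L` number at most
`n / L` ("an element of `SAB_n` may have at most `δ' n` zigzags whose central section has length at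
least `⌈1/δ'⌉`"). [cite: DuminilCopinHammond2013, proof of Prop. 3.2, Case 3 (arXiv v1, pp. 15–16)] -/
theorem card_filter_long_zigzags_mul_le (n : ℕ) (ω : ℕ → Site d) (L : ℕ) :
    #((zigzags n ω).filter fun z => L ≤ z.2 - z.1) * L ≤ n := by
  classical
  set S := (zigzags n ω).filter fun z => L ≤ z.2 - z.1 with hS
  -- the central sections `[i, j)` are pairwise disjoint subsets of `[0, n)`
  have hdisj : (S : Set (ℕ × ℕ)).PairwiseDisjoint fun z => Finset.Ico z.1 z.2 := by
    intro z hz z' hz' hne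
    have h1 := mem_zigzags.1 (mem_filter.1 (Finset.mem_coe.1 hz)).1
    have h2 := mem_zigzags.1 (mem_filter.1 (Finset.mem_coe.1 hz')).1
    rw [Function.onFun, Finset.disjoint_left]
    intro k hk hk'
    rw [Finset.mem_Ico] at hk hk'
    rcases h1.disjoint h2 (by rwa [Prod.mk.eta, Prod.mk.eta]) with h | h <;> omega
  have hsub : S.biUnion (fun z => Finset.Ico z.1 z.2) ⊆ range n := by
    intro k hk
    obtain ⟨z, hz, hk⟩ := mem_biUnion.1 hk
    have h1 := mem_zigzags.1 (mem_filter.1 hz).1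
    rw [Finset.mem_Ico] at hk
    exact mem_range.2 (by have := h1.le_n; omega)
  calc #S * L = ∑ _z ∈ S, L := by rw [sum_const, smul_eq_mul]
    _ ≤ ∑ z ∈ S, #(Finset.Ico z.1 z.2) := sum_le_sum fun z hz => by
        rw [Nat.card_Ico]; exact (mem_filter.1 hz).2
    _ = #(S.biUnion fun z => Finset.Ico z.1 z.2) := (card_biUnion hdisj).symm
    _ ≤ #(range n) := card_le_card hsub
    _ = n := card_range n


/-! ### Definition 3.4: unfolding one zigzag -/

section Unfold

variable {n : ℕ} {ω : ℕ → Site d} {i j : ℕ}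

/-- The first coordinate of `Unf_{(i,j)}(γ)` at time `k`: unchanged up to the point of zig `i`,
reflected in the level `y(γ_i)` on the central section `(i, j]`, and translated by
`2 (y(γ_i) - y(γ_j))` after the point of zag `j`. [cite: DuminilCopinHammond2013, Definition 3.4 (arXiv v1, p. 12)] -/
def zigzagHeight (i j : ℕ) (ω : ℕ → Site d) (k : ℕ) : ℤ :=
  if k ≤ i then ω k 0 else if k ≤ j then 2 * ω i 0 - ω k 0 else ω k 0 + 2 * (ω i 0 - ω j 0)

/-- **Definition 3.4** — `Unf_{(i,j)}(γ) = γ_{[0,i]} ∘ σ_{γ_i}(γ_{[i,j]}) ∘ γ_{[j,n]}`, `σ_v` "the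
orthogonal reflection with respect to the hyperplane `{u : y(u) = y(v)}`" and `∘` the concatenation of
§2.1 (translate the next piece to start where the previous one ends): explicitly, only the first
coordinate changes, by `zigzagHeight`. [cite: DuminilCopinHammond2013, Definition 3.4 (arXiv v1, p. 12)] -/
def unfoldZigzag (i j : ℕ) (ω : ℕ → Site d) : ℕ → Site d :=
  fun k => Function.update (ω k) 0 (zigzagHeight i j ω k)

/-- First coordinate of the unfolded walk. [cite: DuminilCopinHammond2013, Definition 3.4] -/
@[simp] theorem unfoldZigzag_apply_zero (i j : ℕ) (ω : ℕ → Site d) (k : ℕ) :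
    unfoldZigzag i j ω k 0 = zigzagHeight i j ω k := by
  simp [unfoldZigzag]

/-- The other coordinates are unchanged. [cite: DuminilCopinHammond2013, Definition 3.4] -/
@[simp] theorem unfoldZigzag_apply_of_ne (i j : ℕ) (ω : ℕ → Site d) (k : ℕ) {c : Fin d} (hc : c ≠ 0) :
    unfoldZigzag i j ω k c = ω k c := by
  simp [unfoldZigzag, hc]

/-- The three regimes of `zigzagHeight`, as implications (for linear arithmetic).
[cite: DuminilCopinHammond2013, Definition 3.4] -/
theorem zigzagHeight_cases (i j : ℕ) (ω : ℕ → Site d) (k : ℕ) :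
    (k ≤ i → zigzagHeight i j ω k = ω k 0) ∧
      (i < k → k ≤ j → zigzagHeight i j ω k = 2 * ω i 0 - ω k 0) ∧
      (i < k → j < k → zigzagHeight i j ω k = ω k 0 + 2 * (ω i 0 - ω j 0)) := by
  unfold zigzagHeight
  refine ⟨fun h => by rw [if_pos h], fun h1 h2 => by rw [if_neg (not_le.2 h1), if_pos h2],
    fun h1 h2 => by rw [if_neg (not_le.2 h1), if_neg (not_le.2 h2)]⟩

/-- At the point of zig the height is unchanged. [cite: DuminilCopinHammond2013, Definition 3.4] -/
theorem zigzagHeight_zig (i j : ℕ) (ω : ℕ → Site d) : zigzagHeight i j ω i = ω i 0 := by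
  simp [zigzagHeight]

/-- At the point of zag the new height is `2 y_i - y_j`. [cite: DuminilCopinHammond2013, Definition 3.4] -/
theorem zigzagHeight_zag (hij : i ≤ j) (ω : ℕ → Site d) : zigzagHeight i j ω j = 2 * ω i 0 - ω j 0 := by
  rcases hij.eq_or_lt with rfl | hlt
  · rw [(zigzagHeight_cases i i ω i).1 le_rfl]; ring
  · exact (zigzagHeight_cases i j ω j).2.1 hlt le_rfl

/-- After the point of zag (for times `k ≥ j`, `i ≤ j`) the height is translated by `2 (y_i - y_j)`.
[cite: DuminilCopinHammond2013, Definition 3.4] -/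
theorem zigzagHeight_of_zag_le (hij : i ≤ j) (ω : ℕ → Site d) {k : ℕ} (hk : j ≤ k) :
    zigzagHeight i j ω k = ω k 0 + 2 * (ω i 0 - ω j 0) := by
  rcases hk.eq_or_lt with rfl | hlt
  · rw [zigzagHeight_zag hij]; ring
  · exact (zigzagHeight_cases i j ω k).2.2 (lt_of_le_of_lt hij hlt) hlt

/-- Up to the point of zig the walk is unchanged. [cite: DuminilCopinHammond2013, Definition 3.4] -/
theorem unfoldZigzag_of_le (ω : ℕ → Site d) {k : ℕ} (hk : k ≤ i) : unfoldZigzag i j ω k = ω k := by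
  funext c
  by_cases hc : c = 0
  · subst hc; simp [zigzagHeight, hk]
  · simp [hc]

/-- A degenerate zigzag unfolds to the walk itself (`Unf_{(i,i)} = id`): the reason why the forward
count of Case 3 must run over non-degenerate zigzags (see the module docstring).
[cite: DuminilCopinHammond2013, Definition 3.4] -/
theorem unfoldZigzag_self (i : ℕ) (ω : ℕ → Site d) : unfoldZigzag i i ω = ω := by
  funext k c
  by_cases hc : c = 0
  · subst hc
    simp only [unfoldZigzag_apply_zero, zigzagHeight]
    split_ifs <;> omega
  · simp [hc]

/-- **Unfolding a zigzag twice restores the walk** (`Unf_{(i,j)}` is an involution for fixed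
`(i, j)`): the inverse map used to bound preimages in the proof of Proposition 3.2.
[cite: DuminilCopinHammond2013, proof of Prop. 3.2, Case 3 (arXiv v1, p. 16: "the data γ may be reconstructed from φ")] -/
theorem unfoldZigzag_unfoldZigzag (hij : i ≤ j) (ω : ℕ → Site d) :
    unfoldZigzag i j (unfoldZigzag i j ω) = ω := by
  funext k c
  by_cases hc : c = 0
  · subst hc
    have hi := zigzagHeight_zig i j ω
    have hj := zigzagHeight_zag hij ω
    have h1 := zigzagHeight_cases i j ω k
    have h2 := zigzagHeight_cases i j (unfoldZigzag i j ω) k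
    simp only [unfoldZigzag_apply_zero] at h2 ⊢
    rw [hi, hj] at h2
    rcases le_or_gt k i with hki | hki
    · rw [h2.1 hki, h1.1 hki]
    · rcases le_or_gt k j with hkj | hkj
      · rw [h2.2.1 hki hkj, h1.2.1 hki hkj]; ring
      · rw [h2.2.2 hki hkj, h1.2.2 hki hkj]; ring
  · simp [hc]

/-- Consecutive new heights differ by `±` the old difference. [cite: DuminilCopinHammond2013, Definition 3.4 (arXiv v1, p. 12)] -/
theorem zigzagHeight_succ_sub (hij : i ≤ j) (ω : ℕ → Site d) (k : ℕ) :
    zigzagHeight i j ω (k + 1) - zigzagHeight i j ω k = ω (k + 1) 0 - ω k 0 ∨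
      zigzagHeight i j ω (k + 1) - zigzagHeight i j ω k = ω k 0 - ω (k + 1) 0 := by
  have h1 := zigzagHeight_cases i j ω k
  have h2 := zigzagHeight_cases i j ω (k + 1)
  rcases eq_or_ne k i with rfl | hki
  · rw [zigzagHeight_zig]
    rcases eq_or_ne j k with rfl | hjk
    · left; rw [zigzagHeight_of_zag_le le_rfl ω (Nat.le_succ _)]; ring
    · right; rw [h2.2.1 (Nat.lt_succ_self _) (by omega)]; ring
  · rcases eq_or_ne k j with rfl | hkj
    · left; rw [zigzagHeight_zag hij, zigzagHeight_of_zag_le hij ω (Nat.le_succ _)]; ring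
    · omega

/-- The unfolded walk is a nearest-neighbour walk. [cite: DuminilCopinHammond2013, Definition 3.4] -/
theorem unfoldZigzag_adj (hij : i ≤ j) {ω : ℕ → Site d} {k : ℕ} (h : (zdGraph d).Adj (ω k) (ω (k + 1))) :
    (zdGraph d).Adj (unfoldZigzag i j ω k) (unfoldZigzag i j ω (k + 1)) :=
  zdGraph_adj_update_zero h (zigzagHeight_succ_sub hij ω k)

/-- The height at the end: `y(Unf(γ)_n) = y(γ_n) + 2 (y_i - y_j)`. [cite: DuminilCopinHammond2013, Lemma 3.7] -/
theorem zigzagHeight_last (hz : IsZigzag n ω i j) : zigzagHeight i j ω n = ω n 0 + 2 * (ω i 0 - ω j 0) :=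
  zigzagHeight_of_zag_le hz.le ω hz.le_n

/-- **Lemma 3.7** (one zigzag): unfolding does not lower the endpoint, `y(Unf(γ)_n) ≥ y(γ_n)`.
[cite: DuminilCopinHammond2013, Lemma 3.7 (arXiv v1, p. 13)] -/
theorem le_zigzagHeight_last (hz : IsZigzag n ω i j) : ω n 0 ≤ zigzagHeight i j ω n := by
  rw [zigzagHeight_last hz]
  have := hz.zag_le_zig
  omega

/-- Separation of the three pieces of `Unf_{(i,j)}(γ)` for a bridge `γ`: heights up to `i` are
`≤ y_i`, heights on the central section lie in `(y_i, 2y_i - y_j]`, heights after `j` exceed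
`2 y_i - y_j`. [cite: DuminilCopinHammond2013, Definition 3.4 / Lemma 3.7] -/
theorem zigzagHeight_separation (hω : IsBridge n ω) (hz : IsZigzag n ω i j) {k : ℕ} (hk : k ≤ n) :
    (k ≤ i → zigzagHeight i j ω k ≤ ω i 0) ∧
      (i < k → k ≤ j → ω i 0 < zigzagHeight i j ω k ∧ zigzagHeight i j ω k ≤ 2 * ω i 0 - ω j 0) ∧
      (j < k → 2 * ω i 0 - ω j 0 < zigzagHeight i j ω k) := by
  have hc := zigzagHeight_cases i j ω k
  have a1 : k ≤ i → ω k 0 ≤ ω i 0 := fun h => hz.apply_le_zig_of_le hω h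
  have a2 : i < k → k ≤ j → ω k 0 < ω i 0 := fun h h' => hz.apply_lt_zig h h'
  have a3 : i ≤ k → ω j 0 ≤ ω k 0 := fun h => hz.zag_le_apply h hk
  have a4 : j < k → ω j 0 < ω k 0 := fun h => hz.zag_lt_apply h hk
  have hij := hz.le
  refine ⟨fun h => ?_, fun h h' => ⟨?_, ?_⟩, fun h => ?_⟩ <;> omega

/-- **`Unf_{(i,j)}(γ) ∈ SAW_n`**: the unfolded bridge is an `n`-step self-avoiding walk from `0`.
[cite: DuminilCopinHammond2013, Definition 3.4 ("let Unf_{(i,j)}(γ) ∈ SAB_n be given by …")] -/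
theorem unfoldZigzag_mem_saws (hω : ω ∈ bridges d n) (hz : IsZigzag n ω i j) :
    unfoldZigzag i j ω ∈ saws d n := by
  obtain ⟨hs, hbr⟩ := mem_bridges.1 hω
  obtain ⟨h0, hend, hadj, hinj⟩ := mem_saws.1 hs
  have hij := hz.le
  rw [mem_saws]
  refine ⟨by rw [unfoldZigzag_of_le ω (Nat.zero_le _), h0], fun k hk => ?_, fun k hk => unfoldZigzag_adj hij (hadj k hk),
    fun k hk l hl hkl => ?_⟩
  · -- frozen after `n`
    funext c
    by_cases hc : c = 0
    · subst hc
      rw [unfoldZigzag_apply_zero, unfoldZigzag_apply_zero, zigzagHeight_of_zag_le hij ω (hz.le_n.trans hk),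
        zigzagHeight_last hz, hend k hk]
    · simp [hc, hend k hk]
  · -- injective on `[0, n]`
    simp only [Set.mem_setOf_eq] at hk hl
    have hk0 : zigzagHeight i j ω k = zigzagHeight i j ω l := by
      have := congrFun hkl 0; simpa using this
    have hsk := zigzagHeight_separation hbr hz hk
    have hsl := zigzagHeight_separation hbr hz hl
    have hck := zigzagHeight_cases i j ω k
    have hcl := zigzagHeight_cases i j ω l
    have hzz := hz.zag_le_zig
    have hheight : ω k 0 = ω l 0 := by omega
    refine hinj hk hl (eq_of_update_zero_eq hkl hheight)

/-- **Lemma 3.7** (one zigzag): `Unf_{(i,j)}(γ)` is again a bridge. [cite: DuminilCopinHammond2013, Lemma 3.7 (arXiv v1, p. 13)] -/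
theorem isBridge_unfoldZigzag (hω : IsBridge n ω) (hz : IsZigzag n ω i j) : IsBridge n (unfoldZigzag i j ω) := by
  intro k hk1 hkn
  rw [unfoldZigzag_apply_zero, unfoldZigzag_apply_zero, unfoldZigzag_apply_zero,
    (zigzagHeight_cases i j ω 0).1 (Nat.zero_le _), zigzagHeight_last hz]
  have hsk := zigzagHeight_separation hω hz hkn
  have hck := zigzagHeight_cases i j ω k
  have b1 := hω k hk1 hkn
  have b2 : i < k → k ≤ j → ω 0 0 < ω i 0 := fun h h' => (hω i (hz.one_le (by omega)) hz.fst_le_n).1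
  have b3 : 1 ≤ j → ω j 0 ≤ ω n 0 := fun h => (hω j h hz.le_n).2
  have a3 : i ≤ k → ω j 0 ≤ ω k 0 := fun h => hz.zag_le_apply h hkn
  have hzz := hz.zag_le_zig
  constructor <;> omega

/-- `Unf_{(i,j)}(γ) ∈ SAB_n`. [cite: DuminilCopinHammond2013, Definition 3.4 / Lemma 3.7] -/
theorem unfoldZigzag_mem_bridges (hω : ω ∈ bridges d n) (hz : IsZigzag n ω i j) :
    unfoldZigzag i j ω ∈ bridges d n :=
  mem_bridges.2 ⟨unfoldZigzag_mem_saws hω hz, isBridge_unfoldZigzag (mem_bridges.1 hω).2 hz⟩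

/-- **Lemma 3.5 (1)**, zig half: the point of zig is a renewal time of the unfolded bridge.
[cite: DuminilCopinHammond2013, Lemma 3.5 (1) (arXiv v1, p. 12)] -/
theorem isRenewalTime_unfoldZigzag_zig (hω : IsBridge n ω) (hz : IsZigzag n ω i j) :
    IsRenewalTime n (unfoldZigzag i j ω) i := by
  rw [isRenewalTime_iff_heights (isBridge_unfoldZigzag hω hz) hz.fst_le_n]
  simp only [unfoldZigzag_apply_zero, zigzagHeight_zig]
  refine ⟨fun k hk => ?_, fun k hk hkn => ?_⟩
  · rw [(zigzagHeight_cases i j ω k).1 hk]; exact hz.apply_le_zig_of_le hω hk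
  · have := zigzagHeight_separation hω hz hkn
    have := hz.zag_le_zig
    omega

/-- **Lemma 3.5 (1)**, zag half: the point of zag is a renewal time of the unfolded bridge.
[cite: DuminilCopinHammond2013, Lemma 3.5 (1) (arXiv v1, p. 12)] -/
theorem isRenewalTime_unfoldZigzag_zag (hω : IsBridge n ω) (hz : IsZigzag n ω i j) :
    IsRenewalTime n (unfoldZigzag i j ω) j := by
  rw [isRenewalTime_iff_heights (isBridge_unfoldZigzag hω hz) hz.le_n]
  simp only [unfoldZigzag_apply_zero, zigzagHeight_zag hz.le]
  refine ⟨fun k hk => ?_, fun k hk hkn => ?_⟩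
  · have := zigzagHeight_separation hω hz (hk.trans hz.le_n)
    have := hz.zag_le_zig
    omega
  · exact (zigzagHeight_separation hω hz hkn).2.2 hk

/-- Unfolding a zigzag keeps every existing renewal time. [cite: DuminilCopinHammond2013, proof of Prop. 3.2, Case 3 (arXiv v1, pp. 15–16)] -/
theorem IsRenewalTime.unfoldZigzag (hω : IsBridge n ω) (hz : IsZigzag n ω i j) {r : ℕ}
    (hr : IsRenewalTime n ω r) : IsRenewalTime n (unfoldZigzag i j ω) r := by
  have hrn := hr.1
  rw [isRenewalTime_iff_heights hω hrn] at hr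
  rw [isRenewalTime_iff_heights (isBridge_unfoldZigzag hω hz) hrn]
  simp only [unfoldZigzag_apply_zero]
  have hsr := zigzagHeight_separation hω hz hrn
  have hcr := zigzagHeight_cases i j ω r
  have hzi : i ≤ n := hz.fst_le_n
  have hzj : j ≤ n := hz.le_n
  have hij := hz.le
  have hri : r < i → ω r 0 < ω i 0 := fun h => hr.2 i h hzi
  have hrj : r < j → ω r 0 < ω j 0 := fun h => hr.2 j h hzj
  have hir : i ≤ r → ω i 0 ≤ ω r 0 := fun h => hr.1 i h
  have a2 : i < r → r ≤ j → ω r 0 < ω i 0 := fun h h' => hz.apply_lt_zig h h'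
  have hzz := hz.zag_le_zig
  refine ⟨fun k hk => ?_, fun k hk hkn => ?_⟩
  · have h1 := hr.1 k hk
    have hsk := zigzagHeight_separation hω hz (hk.trans hrn)
    have hck := zigzagHeight_cases i j ω k
    omega
  · have h1 := hr.2 k hk hkn
    have hsk := zigzagHeight_separation hω hz hkn
    have hck := zigzagHeight_cases i j ω k
    omega

/-- **Lemma 3.5 (2)**: the other zigzags of `γ` remain zigzags of `Unf_{(i,j)}(γ)`, with the same index
pairs (`Z(γ) ∖ {(i,j)} ⊆ Z(Unf_{(i,j)}(γ))`). [cite: DuminilCopinHammond2013, Lemma 3.5 (2) (arXiv v1, p. 12)] -/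
theorem IsZigzag.unfoldZigzag {i' j' : ℕ} (hz' : IsZigzag n ω i' j') (hω : IsBridge n ω)
    (hz : IsZigzag n ω i j) (hne : (i', j') ≠ (i, j)) : IsZigzag n (unfoldZigzag i j ω) i' j' := by
  have hij := hz.le
  have hij' := hz'.le
  have hjn' := hz'.le_n
  have hin' := hz'.fst_le_n
  have hin := hz.fst_le_n
  have hjn := hz.le_n
  have hzz := hz.zag_le_zig
  rcases hz'.disjoint hz hne with hA | hB
  · -- `j' < i`: the zigzag `(i', j')` lies before the point of zig, where nothing moves
    have hyi' : zigzagHeight i j ω i' = ω i' 0 := (zigzagHeight_cases i j ω i').1 (by omega)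
    have hyj' : zigzagHeight i j ω j' = ω j' 0 := (zigzagHeight_cases i j ω j').1 (by omega)
    have hji : ω j' 0 < ω i 0 := hz'.zag_lt_apply hA hin
    refine ⟨hij', hjn', hz'.2.2.1, fun k hk1 hk2 => ?_, fun k hk1 hk2 => ?_, fun k hk1 hk2 => ?_,
      fun k hk1 hk2 => ?_⟩ <;> simp only [unfoldZigzag_apply_zero]
    · rw [hyi', (zigzagHeight_cases i j ω k).1 (by omega)]; exact hz'.apply_le_zig hk1 hk2
    · rw [hyi', (zigzagHeight_cases i j ω k).1 (by omega)]; exact hz'.apply_lt_zig hk1 hk2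
    · rw [hyj']
      have h1 := hz'.zag_le_apply hk1 hk2
      have hs := zigzagHeight_separation hω hz hk2
      have hc := zigzagHeight_cases i j ω k
      omega
    · rw [hyj']
      have h1 := hz'.zag_lt_apply hk1 hk2
      have hs := zigzagHeight_separation hω hz hk2
      have hc := zigzagHeight_cases i j ω k
      omega
  · -- `j < i'`: the zigzag `(i', j')` lies after the point of zag, where everything is translated
    have hyi' : zigzagHeight i j ω i' = ω i' 0 + 2 * (ω i 0 - ω j 0) :=
      (zigzagHeight_cases i j ω i').2.2 (by omega) hB
    have hyj' : zigzagHeight i j ω j' = ω j' 0 + 2 * (ω i 0 - ω j 0) :=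
      (zigzagHeight_cases i j ω j').2.2 (by omega) (by omega)
    have hji : ω j 0 ≤ ω i' 0 := hz.zag_le_apply (by omega) hin'
    refine ⟨hij', hjn', hz'.2.2.1, fun k hk1 hk2 => ?_, fun k hk1 hk2 => ?_, fun k hk1 hk2 => ?_,
      fun k hk1 hk2 => ?_⟩ <;> simp only [unfoldZigzag_apply_zero]
    · rw [hyi']
      have h1 := hz'.apply_le_zig hk1 hk2
      have a3 : i ≤ k → ω j 0 ≤ ω k 0 := fun h => hz.zag_le_apply h (by omega)
      have hc := zigzagHeight_cases i j ω k
      omega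
    · rw [hyi', (zigzagHeight_cases i j ω k).2.2 (by omega) (by omega)]
      have h1 := hz'.apply_lt_zig hk1 hk2
      omega
    · rw [hyj', (zigzagHeight_cases i j ω k).2.2 (by omega) (by omega)]
      have h1 := hz'.zag_le_apply hk1 hk2
      omega
    · rw [hyj', (zigzagHeight_cases i j ω k).2.2 (by omega) (by omega)]
      have h1 := hz'.zag_lt_apply hk1 hk2
      omega

/-- `(i, j)` itself remains a zigzag of `Unf_{(i,j)}(γ)` only in the degenerate case; what the proofs
use is that its two ends become renewal times (Lemma 3.5 (1)). The full **Lemma 3.5 (2)** on finsets: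
`Z(γ) ∖ {(i,j)} ⊆ Z(Unf_{(i,j)}(γ))`. [cite: DuminilCopinHammond2013, Lemma 3.5 (2)] -/
theorem zigzags_erase_subset_zigzags_unfoldZigzag (hω : IsBridge n ω) (hz : IsZigzag n ω i j) :
    (zigzags n ω).erase (i, j) ⊆ zigzags n (unfoldZigzag i j ω) := by
  intro z hz'
  obtain ⟨a, b⟩ := z
  rw [mem_erase] at hz'
  rw [mem_zigzags]
  exact (mem_zigzags.1 hz'.2).unfoldZigzag hω hz hz'.1

end Unfold


/-! ### Renewal times as a finset; the growth of their number under one unfolding -/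

section Renewal

variable {n : ℕ} {ω : ℕ → Site d} {i j : ℕ}

open Classical in
/-- The renewal times of the `n`-step walk `ω`, as a finset (`R_γ` of §2.2, read as times; the count
`|R_γ|` is its cardinality). [cite: DuminilCopinHammond2013, §2.2] -/
def renewalTimes (n : ℕ) (ω : ℕ → Site d) : Finset ℕ :=
  (range (n + 1)).filter fun r => IsRenewalTime n ω r

/-- Membership in `renewalTimes`. [cite: DuminilCopinHammond2013, §2.2] -/
theorem mem_renewalTimes {r : ℕ} : r ∈ renewalTimes n ω ↔ IsRenewalTime n ω r := by
  classical
  rw [renewalTimes, mem_filter, mem_range]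
  exact ⟨fun h => h.2, fun h => ⟨Nat.lt_succ_of_le h.1, h⟩⟩

/-- `|R_γ| ≤ n + 1`. [cite: DuminilCopinHammond2013, §2.2] -/
theorem card_renewalTimes_le (n : ℕ) (ω : ℕ → Site d) : #(renewalTimes n ω) ≤ n + 1 := by
  classical
  rw [renewalTimes]
  exact (card_filter_le _ _).trans (card_range _).le

/-- For a bridge, the heights of the renewal times are pairwise distinct (indeed increasing), so
renewal times are counted by their heights. [cite: DuminilCopinHammond2013, §2.2] -/
theorem injOn_apply_renewalTimes (hω : IsBridge n ω) :
    Set.InjOn (fun r => ω r 0) (renewalTimes n ω : Set ℕ) := by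
  intro r hr s hs h
  have hr' := mem_renewalTimes.1 (Finset.mem_coe.1 hr)
  have hs' := mem_renewalTimes.1 (Finset.mem_coe.1 hs)
  by_contra hne
  rcases lt_or_gt_of_ne hne with hlt | hlt
  · exact absurd h (apply_lt_apply_of_isRenewalTime hω hr' hs' hlt).ne
  · exact absurd h.symm (apply_lt_apply_of_isRenewalTime hω hs' hr' hlt).ne

/-- **Renewal points created by one unfolding** (the mechanism of the printed (3.9), with an honest
count): a renewal time of `Unf_{(i,j)}(γ)` that is not one of `γ` has its new height in the slab
`[y_j, y_j + 3(y_i - y_j))` — it lies either before `i` at a height in `[y_j, y_i)`, or on the central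
section (heights in `[y_i, 2y_i - y_j]`), or after `j` at a new height in `(2y_i - y_j, 3y_i - 2y_j)`.
[cite: DuminilCopinHammond2013, proof of Prop. 3.2, Case 3, display (3.9)/"equnfoldcomp" (arXiv v1, p. 16)] -/
theorem zigzagHeight_mem_Ico_of_new_renewal (hω : IsBridge n ω) (hz : IsZigzag n ω i j) (hij : i < j)
    {r : ℕ} (hr' : IsRenewalTime n (unfoldZigzag i j ω) r) (hr : ¬ IsRenewalTime n ω r) :
    ω j 0 ≤ zigzagHeight i j ω r ∧ zigzagHeight i j ω r < 3 * ω i 0 - 2 * ω j 0 := by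
  have hrn := hr'.1
  rw [isRenewalTime_iff_heights (isBridge_unfoldZigzag hω hz) hrn] at hr'
  simp only [unfoldZigzag_apply_zero] at hr'
  rw [isRenewalTime_iff_heights hω hrn, not_and_or] at hr
  have hsr := zigzagHeight_separation hω hz hrn
  have hcr := zigzagHeight_cases i j ω r
  have hzz := hz.zag_lt_zig hij
  have ar1 : r ≤ i → ω r 0 ≤ ω i 0 := fun h => hz.apply_le_zig_of_le hω h
  have ar4 : j < r → ω j 0 < ω r 0 := fun h => hz.zag_lt_apply h hrn
  rcases hr with h | h
  · push Not at h
    obtain ⟨k, hk, hlt⟩ := h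
    have h1 := hr'.1 k hk
    have hsk := zigzagHeight_separation hω hz (hk.trans hrn)
    have hck := zigzagHeight_cases i j ω k
    have ak1 : k ≤ i → ω k 0 ≤ ω i 0 := fun h => hz.apply_le_zig_of_le hω h
    have ak2 : i < k → k ≤ j → ω k 0 < ω i 0 := fun h h' => hz.apply_lt_zig h h'
    constructor <;> omega
  · push Not at h
    obtain ⟨k, hk, hkn, hle⟩ := h
    have h1 := hr'.2 k hk hkn
    have hsk := zigzagHeight_separation hω hz hkn
    have hck := zigzagHeight_cases i j ω k
    have ak3 : i ≤ k → ω j 0 ≤ ω k 0 := fun h => hz.zag_le_apply h hkn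
    have ak4 : j < k → ω j 0 < ω k 0 := fun h => hz.zag_lt_apply h hkn
    constructor <;> omega

/-- **The number of renewal times grows by at most `3 (y_i - y_j)` under `Unf_{(i,j)}`** — the
single-unfolding form of "the number of renewal points for `Unf_{(i,j)}(χ)` exceeds this number for
`χ` by at most `3(j - i)`". [cite: DuminilCopinHammond2013, proof of Prop. 3.2, Case 3 (arXiv v1, pp. 15–16)] -/
theorem card_renewalTimes_unfoldZigzag_le (hω : ω ∈ bridges d n) (hz : IsZigzag n ω i j) :
    (#(renewalTimes n (unfoldZigzag i j ω)) : ℤ) ≤ #(renewalTimes n ω) + 3 * (ω i 0 - ω j 0) := by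
  classical
  obtain ⟨-, hbr⟩ := mem_bridges.1 hω
  rcases hz.le.eq_or_lt with heq | hij
  · subst heq; simp [unfoldZigzag_self]
  set R' := renewalTimes n (unfoldZigzag i j ω)
  set R := renewalTimes n ω
  have h1 : #R' ≤ #(R' \ R) + #R := card_le_card_sdiff_add_card
  have h2 : #(R' \ R) ≤ (3 * (ω i 0 - ω j 0)).toNat := by
    have hinj : Set.InjOn (fun r => zigzagHeight i j ω r) ((R' \ R : Finset ℕ) : Set ℕ) := by
      intro r hr s hs h
      have := injOn_apply_renewalTimes (isBridge_unfoldZigzag hbr hz)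
        (Finset.mem_coe.2 (mem_sdiff.1 (Finset.mem_coe.1 hr)).1)
        (Finset.mem_coe.2 (mem_sdiff.1 (Finset.mem_coe.1 hs)).1)
      exact this (by simpa using h)
    rw [← card_image_of_injOn hinj]
    calc #((R' \ R).image fun r => zigzagHeight i j ω r)
        ≤ #(Finset.Ico (ω j 0) (3 * ω i 0 - 2 * ω j 0)) := card_le_card fun y hy => by
          obtain ⟨r, hr, rfl⟩ := mem_image.1 hy
          rw [mem_sdiff, mem_renewalTimes, mem_renewalTimes] at hr
          rw [Finset.mem_Ico]
          exact zigzagHeight_mem_Ico_of_new_renewal hbr hz hij hr.1 hr.2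
      _ = (3 * (ω i 0 - ω j 0)).toNat := by rw [Int.card_Ico]; congr 1; ring
  have h3 : ((3 * (ω i 0 - ω j 0)).toNat : ℤ) = 3 * (ω i 0 - ω j 0) :=
    Int.toNat_of_nonneg (by have := hz.zag_le_zig; omega)
  have h4 : (#R' : ℤ) ≤ #(R' \ R) + #R := by exact_mod_cast h1
  have h5 : (#(R' \ R) : ℤ) ≤ (3 * (ω i 0 - ω j 0)).toNat := by exact_mod_cast h2
  omega

/-- The same bound by the length of the central section: `|R(Unf_{(i,j)} γ)| ≤ |R(γ)| + 3 (j - i)`.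
[cite: DuminilCopinHammond2013, proof of Prop. 3.2, Case 3 (arXiv v1, pp. 15–16)] -/
theorem card_renewalTimes_unfoldZigzag_le' (hω : ω ∈ bridges d n) (hz : IsZigzag n ω i j) :
    #(renewalTimes n (unfoldZigzag i j ω)) ≤ #(renewalTimes n ω) + 3 * (j - i) := by
  have h1 := card_renewalTimes_unfoldZigzag_le hω hz
  have h2 := hz.zig_sub_zag_le (mem_saws.1 (mem_bridges.1 hω).1).2.2.1
  have h3 := hz.le
  zify [h3]
  omega

end Renewal

/-! ### Definition 3.6: unfolding a set of zigzags at once -/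

section UnfoldMany

variable {n : ℕ} {ω : ℕ → Site d}

/-- The total change of the first coordinate at time `k` produced by unfolding every pair of `Z`:
each `(i, j) ∈ Z` with `j < k` contributes the translation `2 (y_i - y_j)`, and the (at most one, for
disjoint pairs) `(i, j) ∈ Z` with `i < k ≤ j` contributes the reflection term `2 (y_i - y_k)`.
[cite: DuminilCopinHammond2013, Definition 3.6 (arXiv v1, p. 12)] -/
def zigzagsShift (Z : Finset (ℕ × ℕ)) (ω : ℕ → Site d) (k : ℕ) : ℤ :=
  ∑ z ∈ Z, ((if z.2 < k then 2 * (ω z.1 0 - ω z.2 0) else 0) +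
    (if z.1 < k ∧ k ≤ z.2 then 2 * (ω z.1 0 - ω k 0) else 0))

/-- **Definition 3.6** — `Unf_Z(γ)`, "the bridge obtained by iteratively applying to `γ` the maps `Unf_z`
for `z ∈ Z`" (in any order, by Lemma 3.5 (3)); typed by the explicit closed form of that iteration (only
the first coordinate changes, by `zigzagsShift`), and PROVED below to be the iteration
(`unfoldZigzags_insert`, in any order). Total in `(Z, ω)`; the hypotheses `Z ⊆ Z(γ)`, `γ ∈ SAB_n` appear
only in the lemmas. [cite: DuminilCopinHammond2013, Definition 3.6 (arXiv v1, p. 12)] -/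
def unfoldZigzags (Z : Finset (ℕ × ℕ)) (ω : ℕ → Site d) : ℕ → Site d :=
  fun k => Function.update (ω k) 0 (ω k 0 + zigzagsShift Z ω k)

/-- First coordinate of `Unf_Z(γ)`. [cite: DuminilCopinHammond2013, Definition 3.6] -/
@[simp] theorem unfoldZigzags_apply_zero (Z : Finset (ℕ × ℕ)) (ω : ℕ → Site d) (k : ℕ) :
    unfoldZigzags Z ω k 0 = ω k 0 + zigzagsShift Z ω k := by
  simp [unfoldZigzags]

/-- The other coordinates are unchanged. [cite: DuminilCopinHammond2013, Definition 3.6] -/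
@[simp] theorem unfoldZigzags_apply_of_ne (Z : Finset (ℕ × ℕ)) (ω : ℕ → Site d) (k : ℕ) {c : Fin d}
    (hc : c ≠ 0) : unfoldZigzags Z ω k c = ω k c := by
  simp [unfoldZigzags, hc]

/-- Unfolding no zigzag is the identity. [cite: DuminilCopinHammond2013, Definition 3.6] -/
@[simp] theorem unfoldZigzags_empty (ω : ℕ → Site d) : unfoldZigzags ∅ ω = ω := by
  funext k c
  by_cases hc : c = 0
  · subst hc; simp [zigzagsShift]
  · simp [hc]

/-- Two walks with the same first coordinates and the same other coordinates are equal. [cite: MadrasSlade1993, §3.1 (proof of Proposition 3.1.5: only the first coordinate is reflected)] -/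
theorem walk_ext {ξ ξ' : ℕ → Site d} (h0 : ∀ k, ξ k 0 = ξ' k 0) (h1 : ∀ k (c : Fin d), c ≠ 0 → ξ k c = ξ' k c) :
    ξ = ξ' := by
  funext k c
  by_cases hc : c = 0
  · subst hc; exact h0 k
  · exact h1 k c hc

/-- **Admissible** sets of pairs: `i ≤ j` for every pair, and distinct pairs have disjoint comparable
index intervals. Every subset of the zigzags of a bridge is admissible (Lemma 3.3 (1)).
[cite: DuminilCopinHammond2013, Lemma 3.3 (1) / Definition 3.6] -/
def ZigzagAdmissible (Z : Finset (ℕ × ℕ)) : Prop :=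
  (∀ z ∈ Z, z.1 ≤ z.2) ∧ ∀ z ∈ Z, ∀ z' ∈ Z, z ≠ z' → z.2 < z'.1 ∨ z'.2 < z.1

/-- Subsets of admissible sets are admissible. [cite: DuminilCopinHammond2013, Lemma 3.3 (1) (arXiv v1, p. 12)] -/
theorem ZigzagAdmissible.mono {Z Z' : Finset (ℕ × ℕ)} (h : ZigzagAdmissible Z) (hsub : Z' ⊆ Z) :
    ZigzagAdmissible Z' :=
  ⟨fun z hz => h.1 z (hsub hz), fun z hz z' hz' hne => h.2 z (hsub hz) z' (hsub hz') hne⟩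

/-- Subsets of `Z(γ)` are admissible. [cite: DuminilCopinHammond2013, Lemma 3.3 (1)] -/
theorem zigzagAdmissible_of_subset {Z : Finset (ℕ × ℕ)} (hZ : Z ⊆ zigzags n ω) : ZigzagAdmissible Z := by
  refine ⟨fun z hz => (mem_zigzags.1 (hZ hz)).le, fun z hz z' hz' hne => ?_⟩
  obtain ⟨a, b⟩ := z
  obtain ⟨a', b'⟩ := z'
  exact (mem_zigzags.1 (hZ hz)).disjoint (mem_zigzags.1 (hZ hz')) hne

/-- On the index interval `[i, j]` of a pair disjoint from (and comparable to) every pair of `Z`, the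
shift of `Z` is constant. [cite: DuminilCopinHammond2013, Lemma 3.5 (3) / Definition 3.6] -/
theorem zigzagsShift_eq_of_disjoint {Z : Finset (ℕ × ℕ)} {i j : ℕ}
    (hZ : ∀ z ∈ Z, z.1 ≤ z.2 ∧ (z.2 < i ∨ j < z.1)) {k : ℕ} (hik : i ≤ k) (hkj : k ≤ j) :
    zigzagsShift Z ω k = zigzagsShift Z ω i := by
  unfold zigzagsShift
  refine sum_congr rfl fun z hz => ?_
  obtain ⟨h1, h2⟩ := hZ z hz
  have e1 : (z.2 < k ↔ z.2 < i) := by omega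
  have e2 : ¬ (z.1 < k ∧ k ≤ z.2) := by omega
  have e3 : ¬ (z.1 < i ∧ i ≤ z.2) := by omega
  simp only [e2, e3, if_false, add_zero]
  by_cases h : z.2 < i
  · rw [if_pos (e1.2 h), if_pos h]
  · rw [if_neg (mt e1.1 h), if_neg h]

/-- **`Unf_{Z ∪ {z}} = Unf_z ∘ Unf_Z`** (the new pair unfolded last): the closed form IS the iteration of
Definition 3.6. [cite: DuminilCopinHammond2013, Definition 3.6 / Lemma 3.5 (3) (arXiv v1, p. 12)] -/
theorem unfoldZigzags_insert {Z : Finset (ℕ × ℕ)} {z : ℕ × ℕ} (hz : z ∉ Z)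
    (hadm : ZigzagAdmissible (insert z Z)) :
    unfoldZigzags (insert z Z) ω = unfoldZigzag z.1 z.2 (unfoldZigzags Z ω) := by
  obtain ⟨i, j⟩ := z
  have hij : i ≤ j := hadm.1 (i, j) (mem_insert_self _ _)
  have hZ : ∀ z' ∈ Z, z'.1 ≤ z'.2 ∧ (z'.2 < i ∨ j < z'.1) := fun z' hz' =>
    ⟨hadm.1 z' (mem_insert_of_mem hz'), by
      have := hadm.2 (i, j) (mem_insert_self _ _) z' (mem_insert_of_mem hz')
        (fun h => hz (h ▸ hz'))
      exact this.symm⟩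
  refine walk_ext (fun k => ?_) (fun k c hc => by simp [hc])
  rw [unfoldZigzags_apply_zero, unfoldZigzag_apply_zero]
  have hsum : zigzagsShift (insert (i, j) Z) ω k = zigzagsShift Z ω k +
      ((if j < k then 2 * (ω i 0 - ω j 0) else 0) + (if i < k ∧ k ≤ j then 2 * (ω i 0 - ω k 0) else 0)) := by
    rw [zigzagsShift, sum_insert hz, zigzagsShift]; ring
  rw [hsum]
  have hc := zigzagHeight_cases i j (unfoldZigzags Z ω) k
  simp only [unfoldZigzags_apply_zero] at hc
  rcases le_or_gt k i with hki | hki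
  · rw [hc.1 hki, if_neg (by omega), if_neg (by omega)]; ring
  · rcases le_or_gt k j with hkj | hkj
    · rw [hc.2.1 hki hkj, if_neg (by omega), if_pos ⟨hki, hkj⟩,
        zigzagsShift_eq_of_disjoint hZ hki.le hkj]; ring
    · rw [hc.2.2 hki hkj, if_pos hkj, if_neg (by omega),
        zigzagsShift_eq_of_disjoint hZ hij le_rfl]; ring

/-- **`Unf_{Z ∪ {z}} = Unf_Z ∘ Unf_z`** (the new pair unfolded first): with the previous lemma, this is
**Lemma 3.5 (3)** — "the order of application of the maps `Unf_z` is immaterial".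
[cite: DuminilCopinHammond2013, Lemma 3.5 (3) (arXiv v1, p. 12)] -/
theorem unfoldZigzags_insert' {Z : Finset (ℕ × ℕ)} {z : ℕ × ℕ} (hz : z ∉ Z)
    (hadm : ZigzagAdmissible (insert z Z)) :
    unfoldZigzags (insert z Z) ω = unfoldZigzags Z (unfoldZigzag z.1 z.2 ω) := by
  classical
  induction Z using Finset.induction_on generalizing ω with
  | empty => rw [unfoldZigzags_insert hz hadm, unfoldZigzags_empty, unfoldZigzags_empty]
  | @insert z' Z hz' ih =>
    have hzZ : z ∉ Z := fun h => hz (mem_insert_of_mem h)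
    have hne : z ≠ z' := fun h => hz (h ▸ mem_insert_self _ _)
    have h1 : insert z (insert z' Z) = insert z' (insert z Z) := Finset.insert_comm z z' Z
    rw [h1, unfoldZigzags_insert (by simp [hz', Ne.symm hne]) (h1 ▸ hadm),
      ih hzZ (hadm.mono (by intro x hx; simp only [mem_insert] at hx ⊢; tauto)),
      unfoldZigzags_insert hz' (hadm.mono (subset_insert _ _))]

/-- **Lemma 3.5 (3)** (commutation): `Unf_{z₂} (Unf_{z₁} γ) = Unf_{z₁} (Unf_{z₂} γ)` for two admissible
pairs. [cite: DuminilCopinHammond2013, Lemma 3.5 (3) (arXiv v1, p. 12)] -/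
theorem unfoldZigzag_comm {z₁ z₂ : ℕ × ℕ} (hne : z₁ ≠ z₂) (hadm : ZigzagAdmissible {z₁, z₂}) :
    unfoldZigzag z₂.1 z₂.2 (unfoldZigzag z₁.1 z₁.2 ω) = unfoldZigzag z₁.1 z₁.2 (unfoldZigzag z₂.1 z₂.2 ω) := by
  classical
  have h12 : z₂ ∉ ({z₁} : Finset (ℕ × ℕ)) := by simp [Ne.symm hne]
  have hadm' : ZigzagAdmissible (insert z₂ {z₁}) := by rwa [Finset.pair_comm] at hadm
  have e1 := unfoldZigzags_insert (ω := ω) h12 hadm'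
  have e2 := unfoldZigzags_insert' (ω := ω) h12 hadm'
  have s1 : unfoldZigzags {z₁} ω = unfoldZigzag z₁.1 z₁.2 ω := by
    have := unfoldZigzags_insert (ω := ω) (Finset.notMem_empty z₁) (hadm.mono (by simp))
    simpa using this
  have s2 : unfoldZigzags {z₁} (unfoldZigzag z₂.1 z₂.2 ω) = unfoldZigzag z₁.1 z₁.2 (unfoldZigzag z₂.1 z₂.2 ω) := by
    have := unfoldZigzags_insert (ω := unfoldZigzag z₂.1 z₂.2 ω) (Finset.notMem_empty z₁) (hadm.mono (by simp))
    simpa using this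
  rw [← s1, ← e1, e2, s2]

/-- `Unf_{{z}} = Unf_z`. [cite: DuminilCopinHammond2013, Definition 3.6] -/
theorem unfoldZigzags_singleton {i j : ℕ} (hij : i ≤ j) : unfoldZigzags {(i, j)} ω = unfoldZigzag i j ω := by
  have := unfoldZigzags_insert (ω := ω) (Finset.notMem_empty (i, j))
    ⟨fun z hz => by simp at hz; subst hz; exact hij, fun z hz z' hz' hne => by simp at hz hz'; subst hz hz'; exact absurd rfl hne⟩
  simpa using this

/-- **`Unf_Z` is an involution for admissible `Z`**: unfolding the same pairs twice restores the walk.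
This is the reconstruction "the data `γ` may be reconstructed from `φ` provided that the pairs …
are known" — `γ = Unf_Z(φ)`. [cite: DuminilCopinHammond2013, proof of Prop. 3.2, Case 3 (arXiv v1, pp. 15–16)] -/
theorem unfoldZigzags_unfoldZigzags {Z : Finset (ℕ × ℕ)} (hadm : ZigzagAdmissible Z) :
    unfoldZigzags Z (unfoldZigzags Z ω) = ω := by
  classical
  induction Z using Finset.induction_on generalizing ω with
  | empty => simp
  | @insert z Z hz ih =>
    rw [unfoldZigzags_insert' hz hadm, unfoldZigzags_insert hz hadm,
      unfoldZigzag_unfoldZigzag (hadm.1 z (mem_insert_self _ _)), ih (hadm.mono (subset_insert _ _))]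

/-- For fixed admissible `Z`, `γ ↦ Unf_Z(γ)` is injective. [cite: DuminilCopinHammond2013, proof of Prop. 3.2, Case 3 (arXiv v1, p. 16)] -/
theorem unfoldZigzags_injective {Z : Finset (ℕ × ℕ)} (hadm : ZigzagAdmissible Z) :
    Function.Injective (unfoldZigzags (d := d) Z) := fun ω ω' h => by
  rw [← unfoldZigzags_unfoldZigzags (ω := ω) hadm, h, unfoldZigzags_unfoldZigzags hadm]

/-- **The unfolding package** (Lemmas 3.5 and 3.7 for `Unf_Z`, `Z ⊆ Z(γ)`, `γ ∈ SAB_n`): `Unf_Z(γ)` is an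
`n`-step bridge; the zigzags of `γ` outside `Z` are still zigzags of it; its renewal times contain those
of `γ` and both ends of every pair of `Z`; and their number exceeds `|R_γ|` by at most
`3 Σ_{(i,j) ∈ Z} (y_i - y_j)`. [cite: DuminilCopinHammond2013, Lemmas 3.5, 3.7 and display (3.9) (arXiv v1, pp. 12–13, 16)] -/
theorem unfoldZigzags_spec (hω : ω ∈ bridges d n) {Z : Finset (ℕ × ℕ)} (hZ : Z ⊆ zigzags n ω) :
    unfoldZigzags Z ω ∈ bridges d n ∧
      zigzags n ω \ Z ⊆ zigzags n (unfoldZigzags Z ω) ∧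
      (∀ r, IsRenewalTime n ω r → IsRenewalTime n (unfoldZigzags Z ω) r) ∧
      (∀ z ∈ Z, IsRenewalTime n (unfoldZigzags Z ω) z.1 ∧ IsRenewalTime n (unfoldZigzags Z ω) z.2) ∧
      (#(renewalTimes n (unfoldZigzags Z ω)) : ℤ) ≤
        #(renewalTimes n ω) + 3 * ∑ z ∈ Z, (ω z.1 0 - ω z.2 0) := by
  classical
  induction Z using Finset.induction_on with
  | empty =>
    simp only [unfoldZigzags_empty, sdiff_empty, sum_empty, mul_zero, add_zero]
    exact ⟨hω, Subset.rfl, fun r h => h, fun z h => absurd h (Finset.notMem_empty z), le_rfl⟩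
  | @insert z Z hz ih =>
    obtain ⟨hW, hpers, hmono, hpairs, hcard⟩ := ih ((subset_insert _ _).trans hZ)
    set W := unfoldZigzags Z ω with hWdef
    have hzZZ : z ∈ zigzags n ω := hZ (mem_insert_self _ _)
    have hzW : IsZigzag n W z.1 z.2 := mem_zigzags.1 (hpers (mem_sdiff.2 ⟨hzZZ, hz⟩))
    have hWbr : IsBridge n W := (mem_bridges.1 hW).2
    have hadm : ZigzagAdmissible (insert z Z) := zigzagAdmissible_of_subset hZ
    have hins : unfoldZigzags (insert z Z) ω = unfoldZigzag z.1 z.2 W := unfoldZigzags_insert hz hadm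
    rw [hins]
    refine ⟨unfoldZigzag_mem_bridges hW hzW, fun z' hz' => ?_, fun r hr => (hmono r hr).unfoldZigzag hWbr hzW,
      fun z' hz' => ?_, ?_⟩
    · rw [mem_sdiff, mem_insert, not_or] at hz'
      obtain ⟨a, b⟩ := z'
      have h1 : IsZigzag n W a b := mem_zigzags.1 (hpers (mem_sdiff.2 ⟨hz'.1, hz'.2.2⟩))
      exact mem_zigzags.2 (h1.unfoldZigzag hWbr hzW hz'.2.1)
    · rcases mem_insert.1 hz' with rfl | hz'Z
      · exact ⟨isRenewalTime_unfoldZigzag_zig hWbr hzW, isRenewalTime_unfoldZigzag_zag hWbr hzW⟩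
      · exact ⟨((hpairs z' hz'Z).1).unfoldZigzag hWbr hzW, ((hpairs z' hz'Z).2).unfoldZigzag hWbr hzW⟩
    · have h1 := card_renewalTimes_unfoldZigzag_le hW hzW
      rw [sum_insert hz]
      -- the height drop of `z` in `W` equals that in `ω` (the shift is constant on `[i, j]`)
      have hdrop : W z.1 0 - W z.2 0 = ω z.1 0 - ω z.2 0 := by
        have hZ' : ∀ z' ∈ Z, z'.1 ≤ z'.2 ∧ (z'.2 < z.1 ∨ z.2 < z'.1) := fun z' hz' =>
          ⟨hadm.1 z' (mem_insert_of_mem hz'),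
            (hadm.2 z (mem_insert_self _ _) z' (mem_insert_of_mem hz') (fun h => hz (h ▸ hz'))).symm⟩
        rw [hWdef, unfoldZigzags_apply_zero, unfoldZigzags_apply_zero,
          zigzagsShift_eq_of_disjoint hZ' (hadm.1 z (mem_insert_self _ _)) le_rfl]
        ring
      rw [hdrop] at h1
      linarith

/-- `Unf_Z(γ) ∈ SAB_n`. [cite: DuminilCopinHammond2013, Lemma 3.7 (arXiv v1, p. 13)] -/
theorem unfoldZigzags_mem_bridges (hω : ω ∈ bridges d n) {Z : Finset (ℕ × ℕ)} (hZ : Z ⊆ zigzags n ω) :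
    unfoldZigzags Z ω ∈ bridges d n :=
  (unfoldZigzags_spec hω hZ).1

/-- The endpoint height of `Unf_Z(γ)`: `y(Unf_Z(γ)_n) = y(γ_n) + Σ_{(i,j) ∈ Z} 2 (y_i - y_j)`.
[cite: DuminilCopinHammond2013, Lemma 3.7 (arXiv v1, p. 13)] -/
theorem unfoldZigzags_apply_last {Z : Finset (ℕ × ℕ)} (hZ : ∀ z ∈ Z, z.1 ≤ z.2 ∧ z.2 ≤ n) :
    unfoldZigzags Z ω n 0 = ω n 0 + ∑ z ∈ Z, 2 * (ω z.1 0 - ω z.2 0) := by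
  rw [unfoldZigzags_apply_zero, zigzagsShift]
  congr 1
  refine sum_congr rfl fun z hz => ?_
  obtain ⟨a, b⟩ := z
  obtain ⟨h1, h2⟩ := hZ (a, b) hz
  simp only at h1 h2 ⊢
  rcases h2.eq_or_lt with rfl | hlt
  · rcases h1.eq_or_lt with rfl | hlt'
    · simp
    · rw [if_neg (lt_irrefl _), if_pos ⟨hlt', le_rfl⟩]; ring
  · rw [if_pos hlt, if_neg (by omega)]; ring

/-- **Lemma 3.7**: `y(Unf_Z(γ)_n) ≥ y(γ_n)` for `Z ⊆ Z(γ)` (so `Unf_Z` maps `SAB_{n,v}` into itself).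
[cite: DuminilCopinHammond2013, Lemma 3.7 (arXiv v1, p. 13)] -/
theorem le_unfoldZigzags_apply_last {Z : Finset (ℕ × ℕ)} (hZ : Z ⊆ zigzags n ω) :
    ω n 0 ≤ unfoldZigzags Z ω n 0 := by
  rw [unfoldZigzags_apply_last fun z hz => ⟨(mem_zigzags.1 (hZ hz)).le, (mem_zigzags.1 (hZ hz)).le_n⟩]
  have : 0 ≤ ∑ z ∈ Z, 2 * (ω z.1 0 - ω z.2 0) :=
    sum_nonneg fun z hz => by have := (mem_zigzags.1 (hZ hz)).zag_le_zig; omega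
  linarith

/-- **Lemma 3.5 (1) for `Unf_Z`**: both ends of every unfolded pair are renewal times, so
`|R(Unf_Z(γ))| ≥ 2 |Z| - #{degenerate pairs in Z}`; in particular `|R(Unf_Z(γ))| ≥ |Z|` (count the
points of zig, which are pairwise distinct). [cite: DuminilCopinHammond2013, proof of Prop. 3.2, Case 3, display (3.7) (arXiv v1, p. 15)] -/
theorem card_le_card_renewalTimes_unfoldZigzags (hω : ω ∈ bridges d n) {Z : Finset (ℕ × ℕ)}
    (hZ : Z ⊆ zigzags n ω) : #Z ≤ #(renewalTimes n (unfoldZigzags Z ω)) := by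
  have h := (unfoldZigzags_spec hω hZ).2.2.2.1
  calc #Z = #(Z.image Prod.fst) := (card_image_of_injOn fun z hz z' hz' h =>
        fst_injOn_zigzags n ω (hZ hz) (hZ hz') h).symm
    _ ≤ #(renewalTimes n (unfoldZigzags Z ω)) := card_le_card fun i hi => by
        obtain ⟨z, hz, rfl⟩ := mem_image.1 hi
        exact mem_renewalTimes.2 (h z hz).1

/-- Both ends counted: for pairs with non-trivial central sections, `|R(Unf_Z(γ))| ≥ 2|Z|`.
[cite: DuminilCopinHammond2013, proof of Prop. 3.2, Case 3 (arXiv v1, pp. 15–16)] -/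
theorem two_mul_card_le_card_renewalTimes_unfoldZigzags (hω : ω ∈ bridges d n) {Z : Finset (ℕ × ℕ)}
    (hZ : Z ⊆ zigzags n ω) (hnd : ∀ z ∈ Z, z.1 < z.2) :
    2 * #Z ≤ #(renewalTimes n (unfoldZigzags Z ω)) := by
  classical
  have h := (unfoldZigzags_spec hω hZ).2.2.2.1
  have hadm := zigzagAdmissible_of_subset hZ
  have hdisj : Disjoint (Z.image Prod.fst) (Z.image Prod.snd) := by
    rw [Finset.disjoint_left]
    intro k hk1 hk2
    obtain ⟨z, hz, rfl⟩ := mem_image.1 hk1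
    obtain ⟨z', hz', h'⟩ := mem_image.1 hk2
    have h'' : z'.2 = z.1 := h'
    have hn1 := hnd z hz
    have hn2 := hnd z' hz'
    rcases eq_or_ne z z' with rfl | hne
    · omega
    · rcases hadm.2 z hz z' hz' hne with h1 | h1 <;> omega
  calc 2 * #Z = #(Z.image Prod.fst) + #(Z.image Prod.snd) := by
        rw [card_image_of_injOn fun z hz z' hz' h => fst_injOn_zigzags n ω (hZ hz) (hZ hz') h,
          card_image_of_injOn fun z hz z' hz' h' => ?_]
        · ring
        · -- `Prod.snd` is injective on zigzags too (the point of zag determines the pair by disjointness)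
          by_contra hne
          have h'' : z.2 = z'.2 := h'
          have := hadm.1 z' hz'
          have := hadm.1 z hz
          rcases hadm.2 z hz z' hz' hne with h1 | h1 <;> omega
    _ = #(Z.image Prod.fst ∪ Z.image Prod.snd) := (card_union_of_disjoint hdisj).symm
    _ ≤ #(renewalTimes n (unfoldZigzags Z ω)) := card_le_card fun k hk => by
        rcases mem_union.1 hk with hk | hk
        · obtain ⟨z, hz, rfl⟩ := mem_image.1 hk; exact mem_renewalTimes.2 (h z hz).1
        · obtain ⟨z, hz, rfl⟩ := mem_image.1 hk; exact mem_renewalTimes.2 (h z hz).2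

/-- **Renewal growth for `Unf_Z`** by central-section lengths: `|R(Unf_Z(γ))| ≤ |R(γ)| + 3 Σ_{(i,j)∈Z} (j - i)`;
with `|Z| = δ''n` short zigzags (`j - i ≤ ⌈1/δ'⌉`) this is the printed (3.9)
`|R_φ| ≤ ε_n v_n + 3⌈1/δ'⌉ δ'' v_n`. [cite: DuminilCopinHammond2013, proof of Prop. 3.2, Case 3, display (3.9) (arXiv v1, p. 16)] -/
theorem card_renewalTimes_unfoldZigzags_le (hω : ω ∈ bridges d n) {Z : Finset (ℕ × ℕ)} (hZ : Z ⊆ zigzags n ω) :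
    #(renewalTimes n (unfoldZigzags Z ω)) ≤ #(renewalTimes n ω) + 3 * ∑ z ∈ Z, (z.2 - z.1) := by
  have h1 := (unfoldZigzags_spec hω hZ).2.2.2.2
  have hadj := (mem_saws.1 (mem_bridges.1 hω).1).2.2.1
  have h2 : ∑ z ∈ Z, (ω z.1 0 - ω z.2 0) ≤ ∑ z ∈ Z, ((z.2 - z.1 : ℕ) : ℤ) :=
    sum_le_sum fun z hz => by
      have hzz := mem_zigzags.1 (hZ hz)
      have := hzz.zig_sub_zag_le hadj
      rw [Nat.cast_sub hzz.le]; exact this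
  zify
  linarith

end UnfoldMany


/-! ### Injectivity of `Z ↦ Unf_Z(γ)` over non-degenerate zigzags (the forward count (3.8), repaired) -/

section InjectiveInZ

variable {n : ℕ} {ω : ℕ → Site d}

open Classical in
/-- The non-degenerate zigzags of `γ` that were unfolded to produce `W`, read off from the first step
after each point of zig: unfolding `(i, j)` with `i < j` reverses the sign of the (non-zero) height
increment `y_{i+1} - y_i`, and no other unfolding touches it. A left inverse of `Z ↦ Unf_Z(γ)`.
[cite: DuminilCopinHammond2013, proof of Prop. 3.2, Case 3, display (3.8)/"eqforwardentropy" (arXiv v1, p. 16)] -/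
def usedZigzags (n : ℕ) (ω W : ℕ → Site d) : Finset (ℕ × ℕ) :=
  (zigzags n ω).filter fun z => z.1 < z.2 ∧ W (z.1 + 1) 0 - W z.1 0 ≠ ω (z.1 + 1) 0 - ω z.1 0

/-- **`Z` is recovered from `(γ, Unf_Z(γ))`** for `Z` a set of NON-DEGENERATE zigzags of `γ`. (For a
degenerate pair `Unf_{(i,i)} = id`, so no such statement can hold without the restriction — the
as-printed "the application `Z ↦ Unf_Z(γ)` is one-to-one" needs it.)
[cite: DuminilCopinHammond2013, proof of Prop. 3.2, Case 3 (arXiv v1, pp. 15–16)] -/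
theorem usedZigzags_unfoldZigzags {Z : Finset (ℕ × ℕ)} (hZ : Z ⊆ zigzags n ω) (hnd : ∀ z ∈ Z, z.1 < z.2) :
    usedZigzags n ω (unfoldZigzags Z ω) = Z := by
  classical
  have hadmZZ : ZigzagAdmissible (zigzags n ω) := zigzagAdmissible_of_subset Subset.rfl
  ext ⟨a, b⟩
  rw [usedZigzags, mem_filter]
  constructor
  · rintro ⟨hzz, hab, hne⟩
    by_contra hnot
    apply hne
    -- no pair of `Z` meets `[a, a+1]`: the shift is the same at `a` and `a + 1`
    have hZ' : ∀ z' ∈ Z, z'.1 ≤ z'.2 ∧ (z'.2 < a ∨ a + 1 < z'.1) := fun z' hz' => by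
      refine ⟨(mem_zigzags.1 (hZ hz')).le, ?_⟩
      have hne' : (a, b) ≠ z' := fun h => hnot (h ▸ hz')
      rcases hadmZZ.2 (a, b) hzz z' (hZ hz') hne' with h | h
      · right; simp only at h; omega
      · left; simpa using h
    rw [unfoldZigzags_apply_zero, unfoldZigzags_apply_zero,
      zigzagsShift_eq_of_disjoint hZ' (Nat.le_succ a) le_rfl]
    ring
  · intro hz
    have hzz := hZ hz
    have hab := hnd _ hz
    refine ⟨hzz, hab, ?_⟩
    have hz' : (a, b) ∉ Z.erase (a, b) := Finset.notMem_erase _ _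
    have hins : insert (a, b) (Z.erase (a, b)) = Z := insert_erase hz
    have hadm : ZigzagAdmissible (insert (a, b) (Z.erase (a, b))) := by
      rw [hins]; exact zigzagAdmissible_of_subset hZ
    rw [← hins, unfoldZigzags_insert hz' hadm]
    simp only [unfoldZigzag_apply_zero]
    rw [(zigzagHeight_cases a b (unfoldZigzags (Z.erase (a, b)) ω) (a + 1)).2.1 (Nat.lt_add_one a) hab,
      zigzagHeight_zig]
    -- the shift of `Z ∖ {(a,b)}` is the same at `a` and `a + 1`
    have hZ' : ∀ z' ∈ Z.erase (a, b), z'.1 ≤ z'.2 ∧ (z'.2 < a ∨ a + 1 < z'.1) := fun z' hz'' => by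
      rw [mem_erase] at hz''
      refine ⟨(mem_zigzags.1 (hZ hz''.2)).le, ?_⟩
      rcases hadmZZ.2 (a, b) hzz z' (hZ hz''.2) (Ne.symm hz''.1) with h | h
      · right; simp only at h; omega
      · left; simpa using h
    have e1 : unfoldZigzags (Z.erase (a, b)) ω (a + 1) 0 = ω (a + 1) 0 + zigzagsShift (Z.erase (a, b)) ω a := by
      rw [unfoldZigzags_apply_zero, zigzagsShift_eq_of_disjoint hZ' (Nat.le_add_right a 1) le_rfl]
    have e2 : unfoldZigzags (Z.erase (a, b)) ω a 0 = ω a 0 + zigzagsShift (Z.erase (a, b)) ω a :=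
      unfoldZigzags_apply_zero _ _ _
    have hlt : ω (a + 1) 0 < ω a 0 := (mk_mem_zigzags.1 hzz).apply_lt_zig (Nat.lt_add_one a) hab
    rw [e1, e2]
    omega

/-- **Δ1 — injectivity of `Z ↦ Unf_Z(γ)` on sets of non-degenerate zigzags of `γ`**: for each fixed `γ`,
distinct admissible choices `Z ⊆ {z ∈ Z(γ) : i < j}` give distinct bridges, so
`|{Unf_Z(γ) : Z ⊆ S, |Z| = m}| = binom(|S|, m)` for any set `S` of non-degenerate (e.g. short) zigzags.
[cite: DuminilCopinHammond2013, proof of Prop. 3.2, Case 3, display (3.8) (arXiv v1, p. 16)] -/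
theorem unfoldZigzags_injOn (n : ℕ) (ω : ℕ → Site d) :
    Set.InjOn (fun Z : Finset (ℕ × ℕ) => unfoldZigzags Z ω)
      (↑(((zigzags n ω).filter fun z => z.1 < z.2).powerset) : Set (Finset (ℕ × ℕ))) := by
  intro Z hZ Z' hZ' h
  rw [Finset.mem_coe, mem_powerset] at hZ hZ'
  have h1 := usedZigzags_unfoldZigzags (ω := ω) (fun z hz => (mem_filter.1 (hZ hz)).1)
    (fun z hz => (mem_filter.1 (hZ hz)).2)
  have h2 := usedZigzags_unfoldZigzags (ω := ω) (fun z hz => (mem_filter.1 (hZ' hz)).1)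
    (fun z hz => (mem_filter.1 (hZ' hz)).2)
  rw [← h1, ← h2]
  exact congrArg _ h

open Classical in
/-- Counting form of Δ1: the images `Unf_Z(γ)`, `Z` ranging over the `m`-subsets of a set `S` of
non-degenerate zigzags of `γ`, are `binom(|S|, m)` distinct bridges.
[cite: DuminilCopinHammond2013, proof of Prop. 3.2, Case 3, display (3.8) (arXiv v1, p. 16)] -/
theorem card_image_unfoldZigzags_powersetCard {S : Finset (ℕ × ℕ)} (hS : S ⊆ zigzags n ω)
    (hnd : ∀ z ∈ S, z.1 < z.2) (m : ℕ) :
    #((S.powersetCard m).image fun Z => unfoldZigzags Z ω) = (#S).choose m := by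
  rw [card_image_of_injOn, card_powersetCard]
  intro Z hZ Z' hZ' h
  refine unfoldZigzags_injOn n ω ?_ ?_ h <;>
    simp only [Finset.coe_powerset, Set.mem_preimage, Set.mem_powerset_iff, Finset.coe_subset] <;>
    intro z hz
  · exact mem_filter.2 ⟨hS ((mem_powersetCard.1 (Finset.mem_coe.1 hZ)).1 hz),
      hnd z ((mem_powersetCard.1 (Finset.mem_coe.1 hZ)).1 hz)⟩
  · exact mem_filter.2 ⟨hS ((mem_powersetCard.1 (Finset.mem_coe.1 hZ')).1 hz),
      hnd z ((mem_powersetCard.1 (Finset.mem_coe.1 hZ')).1 hz)⟩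

/-- Degenerate zigzags are few when renewal points are few: `#{(i,i) ∈ Z(γ)} ≤ |R_γ|` (Lemma 3.3 (2)),
so a bridge with `≥ 2δ'n` zigzags and `≤ ε n` renewal times has `≥ (2δ' - ε) n` non-degenerate ones.
[cite: DuminilCopinHammond2013, Lemma 3.3 (2) / proof of Prop. 3.2, Case 3 (arXiv v1, pp. 12, 15)] -/
theorem card_degenerate_zigzags_le (hω : IsBridge n ω) :
    #((zigzags n ω).filter fun z => z.1 = z.2) ≤ #(renewalTimes n ω) := by
  refine card_le_card_of_injOn Prod.fst (fun z hz => ?_) fun z hz z' hz' h =>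
    fst_injOn_zigzags n ω (mem_filter.1 hz).1 (mem_filter.1 hz').1 h
  obtain ⟨hzz, heq⟩ := mem_filter.1 hz
  obtain ⟨a, b⟩ := z
  simp only at heq; subst heq
  exact mem_renewalTimes.2 ((mem_zigzags.1 hzz).isRenewalTime_of_eq hω)

end InjectiveInZ

/-! ### Levels crossed once and renewal points (used in Case 1 and in the last step of Thm 3.1) -/

section Levels

variable {n : ℕ} {ω : ℕ → Site d}

open Classical in
/-- `V_{h,h+1}(γ)` as a finset of STEP-TIMES: the times `i < n` at which the step `(γ_i, γ_{i+1})` runs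
between the levels `h` and `h + 1` (in either direction). Its cardinality is the `|V_{h,h+1}|` of the
source (`levelVisits` in the lane's K2 file, same body). [cite: DuminilCopinHammond2013, §3 (definition of V_{h,h+1}, arXiv v1, p. 11)] -/
def levelSteps (n : ℕ) (ω : ℕ → Site d) (h : ℤ) : Finset ℕ :=
  (range n).filter fun i => (ω i 0 = h ∧ ω (i + 1) 0 = h + 1) ∨ (ω i 0 = h + 1 ∧ ω (i + 1) 0 = h)

/-- Membership in `levelSteps`. [cite: DuminilCopinHammond2013, §3] -/
theorem mem_levelSteps {h : ℤ} {i : ℕ} : i ∈ levelSteps n ω h ↔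
    i < n ∧ ((ω i 0 = h ∧ ω (i + 1) 0 = h + 1) ∨ (ω i 0 = h + 1 ∧ ω (i + 1) 0 = h)) := by
  classical
  rw [levelSteps, mem_filter, mem_range]

/-- **A renewal time `r < n` makes its level crossed exactly once**: "if `γ_i ∈ R_γ` for some
`0 ≤ i ≤ n - 1`, note that `|V_{h,h+1}| = 1` for `h = y(γ_i)`" (Case 1).
[cite: DuminilCopinHammond2013, proof of Prop. 3.2, Case 1 (arXiv v1, p. 14)] -/
theorem levelSteps_eq_singleton_of_isRenewalTime (hω : ω ∈ bridges d n) {r : ℕ}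
    (hr : IsRenewalTime n ω r) (hrn : r < n) : levelSteps n ω (ω r 0) = {r} := by
  obtain ⟨hs, hbr⟩ := mem_bridges.1 hω
  have hadj := (mem_saws.1 hs).2.2.1
  rw [isRenewalTime_iff_heights hbr hrn.le] at hr
  ext k
  rw [mem_levelSteps, mem_singleton]
  constructor
  · rintro ⟨hkn, hk⟩
    by_contra hne
    rcases lt_or_gt_of_ne hne with hlt | hlt
    · have h1 := hr.1 k hlt.le
      have h2 := hr.1 (k + 1) hlt
      omega
    · have h1 := hr.2 k hlt hkn.le
      have h2 := hr.2 (k + 1) (by omega) hkn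
      omega
  · rintro rfl
    refine ⟨hrn, Or.inl ⟨rfl, ?_⟩⟩
    have h1 := hr.2 (k + 1) (Nat.lt_succ_self _) hrn
    have h2 := abs_sub_le_one_of_adj (hadj k hrn) 0
    rw [abs_le] at h2
    omega

/-- The last time at which the first coordinate is `≤ ℓ` (the tree's `lastBelow`): specification when
such a time exists. [cite: MadrasSlade1993, §3.1 (proof of Proposition 3.1.5)] -/
theorem lastBelow_spec {ξ : ℕ → Site d} {ℓ : ℤ} (hex : ∃ i ≤ n, ξ i 0 ≤ ℓ) :
    lastBelow n ξ ℓ ≤ n ∧ ξ (lastBelow n ξ ℓ) 0 ≤ ℓ ∧ ∀ i, lastBelow n ξ ℓ < i → i ≤ n → ℓ < ξ i 0 := by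
  classical
  have hne : ((range (n + 1)).filter fun i => ξ i 0 ≤ ℓ).Nonempty := by
    obtain ⟨i, hi, h⟩ := hex
    exact ⟨i, mem_filter.2 ⟨mem_range.2 (Nat.lt_succ_of_le hi), h⟩⟩
  have hdef : lastBelow n ξ ℓ = ((range (n + 1)).filter fun i => ξ i 0 ≤ ℓ).max' hne := by
    rw [lastBelow, dif_pos hne]
  have hmem := Finset.max'_mem _ hne
  rw [← hdef, mem_filter, mem_range] at hmem
  refine ⟨Nat.le_of_lt_succ hmem.1, hmem.2, fun i hi hin => ?_⟩
  by_contra hle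
  have hi' : i ∈ (range (n + 1)).filter (fun i => ξ i 0 ≤ ℓ) :=
    mem_filter.2 ⟨mem_range.2 (Nat.lt_succ_of_le hin), le_of_not_gt hle⟩
  have := Finset.le_max' _ _ hi'
  rw [← hdef] at this
  omega

/-- A step of a nearest-neighbour walk from a height `≤ ℓ` to a height `> ℓ` goes from `ℓ` to `ℓ + 1`.
[cite: DuminilCopinHammond2013, §3 (levels E_h and V_{h,h+1}, arXiv v1, p. 11)] -/
theorem step_up_eq {k : ℕ} (hadj : (zdGraph d).Adj (ω k) (ω (k + 1))) {ℓ : ℤ} (h1 : ω k 0 ≤ ℓ)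
    (h2 : ℓ < ω (k + 1) 0) : ω k 0 = ℓ ∧ ω (k + 1) 0 = ℓ + 1 := by
  have := abs_sub_le_one_of_adj hadj 0
  rw [abs_le] at this
  omega

/-- First passage above a level: if `y_0 ≤ ℓ < y_s` then some step before `s` runs from `ℓ` up to
`ℓ + 1`. [cite: DuminilCopinHammond2013, §3 (levels E_h and V_{h,h+1}, arXiv v1, p. 11)] -/
theorem exists_step_up (hadj : ∀ i < n, (zdGraph d).Adj (ω i) (ω (i + 1))) {ℓ : ℤ} {s : ℕ} (hs : s ≤ n)
    (h0 : ω 0 0 ≤ ℓ) (h1 : ℓ < ω s 0) : ∃ k, k < s ∧ ω k 0 = ℓ ∧ ω (k + 1) 0 = ℓ + 1 := by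
  induction s with
  | zero => omega
  | succ s ih =>
    by_cases h : ℓ < ω s 0
    · obtain ⟨k, hk, hk1, hk2⟩ := ih (by omega) h
      exact ⟨k, by omega, hk1, hk2⟩
    · exact ⟨s, Nat.lt_succ_self s, step_up_eq (hadj s (by omega)) (not_lt.1 h) h1⟩

/-- First passage below a level: if `y_s > ℓ ≥ y_u` with `s ≤ u` then some step in `[s, u)` runs from
`ℓ + 1` down to `ℓ`. [cite: DuminilCopinHammond2013, §3 (levels E_h and V_{h,h+1}, arXiv v1, p. 11)] -/
theorem exists_step_down (hadj : ∀ i < n, (zdGraph d).Adj (ω i) (ω (i + 1))) {ℓ : ℤ} {s u : ℕ}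
    (hsu : s ≤ u) (hu : u ≤ n) (h0 : ℓ < ω s 0) (h1 : ω u 0 ≤ ℓ) :
    ∃ k, s ≤ k ∧ k < u ∧ ω k 0 = ℓ + 1 ∧ ω (k + 1) 0 = ℓ := by
  induction u with
  | zero =>
    have : s = 0 := by omega
    subst this; omega
  | succ u ih =>
    by_cases h : ω u 0 ≤ ℓ
    · have hsu' : s ≤ u := by
        by_contra hlt
        have : s = u + 1 := by omega
        subst this; omega
      obtain ⟨k, hk1, hk2, hk3, hk4⟩ := ih hsu' (by omega) h
      exact ⟨k, hk1, by omega, hk3, hk4⟩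
    · have hsu' : s ≤ u := by
        by_contra hlt
        have : s = u + 1 := by omega
        subst this; omega
      have := abs_sub_le_one_of_adj (hadj u (by omega)) 0
      rw [abs_le] at this
      exact ⟨u, hsu', Nat.lt_succ_self u, by omega, by omega⟩

/-- **A level crossed at most once carries a renewal point**: "if `V_{h,h+1}` has only one element `e`,
then the endpoint `u` of `e` with `y(u) = h` belongs to `R_γ`" — for a bridge and a level
`0 ≤ h < y(γ_n)` with `|V_{h,h+1}| ≤ 1`, the last time at height `≤ h` is a renewal time at height
exactly `h`. [cite: DuminilCopinHammond2013, §3 (before Prop. 3.2) and proof of Thm 3.1 (arXiv v1, pp. 11–12)] -/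
theorem exists_isRenewalTime_of_card_levelSteps_le_one (hω : ω ∈ bridges d n) {h : ℤ} (h0 : 0 ≤ h)
    (hh : h < ω n 0) (hV : #(levelSteps n ω h) ≤ 1) :
    ∃ r, r < n ∧ IsRenewalTime n ω r ∧ ω r 0 = h := by
  obtain ⟨hs, hbr⟩ := mem_bridges.1 hω
  obtain ⟨hω0, -, hadj, -⟩ := mem_saws.1 hs
  have hy0 : ω 0 0 = 0 := by rw [hω0]; rfl
  obtain ⟨htn, hyt, hafter⟩ := lastBelow_spec (ξ := ω) (ℓ := h) ⟨0, Nat.zero_le _, by rw [hy0]; exact h0⟩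
  set t := lastBelow n ω h
  have htn' : t < n := lt_of_le_of_ne htn fun heq => by rw [heq] at hyt; omega
  obtain ⟨hyt', hyt1⟩ := step_up_eq (hadj t htn') hyt (hafter (t + 1) (Nat.lt_succ_self t) htn')
  have htV : t ∈ levelSteps n ω h := mem_levelSteps.2 ⟨htn', Or.inl ⟨hyt', hyt1⟩⟩
  refine ⟨t, htn', ?_, hyt'⟩
  rw [isRenewalTime_iff_heights hbr htn]
  refine ⟨fun k hk => ?_, fun k hk hkn => by rw [hyt']; exact hafter k hk hkn⟩
  by_contra hlt
  rw [not_le, hyt'] at hlt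
  -- a second crossing before `k`, contradicting `|V_{h,h+1}| ≤ 1`
  obtain ⟨k', hk', hk'1, hk'2⟩ := exists_step_up hadj (hk.trans htn) (by rw [hy0]; exact h0) hlt
  have hk'V : k' ∈ levelSteps n ω h := mem_levelSteps.2 ⟨by omega, Or.inl ⟨hk'1, hk'2⟩⟩
  have hne : k' ≠ t := by omega
  have : 2 ≤ #(levelSteps n ω h) := by
    rw [← card_pair hne]
    exact card_le_card (by
      intro x hx
      rcases mem_insert.1 hx with rfl | hx
      · exact hk'V
      · rw [mem_singleton] at hx; subst hx; exact htV)
  omega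

open Classical in
/-- **Levels crossed at most once are counted by renewal times**: for a bridge,
`#{0 ≤ h < y(γ_n) : |V_{h,h+1}| ≤ 1} + 1 ≤ |R_γ|` (the renewal time `n` itself sits at the top level).
This is the inclusion `SAB^1_{n,v,δ} ⊆ {γ : |R_γ| ≥ δ n}` of the proof of Theorem 3.1.
[cite: DuminilCopinHammond2013, proof of Thm 3.1 (arXiv v1, pp. 11–12)] -/
theorem card_sparse_levels_succ_le_card_renewalTimes (hω : ω ∈ bridges d n) :
    #((range (ω n 0).toNat).filter fun h : ℕ => #(levelSteps n ω (h : ℤ)) ≤ 1) + 1 ≤ #(renewalTimes n ω) := by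
  classical
  obtain ⟨-, hbr⟩ := mem_bridges.1 hω
  set L := (range (ω n 0).toNat).filter fun h : ℕ => #(levelSteps n ω (h : ℤ)) ≤ 1
  -- choose a renewal time below `n` for each sparse level
  have hch : ∀ h ∈ L, ∃ r, r < n ∧ IsRenewalTime n ω r ∧ ω r 0 = (h : ℤ) := fun h hh => by
    obtain ⟨hh1, hh2⟩ := mem_filter.1 hh
    rw [mem_range] at hh1
    exact exists_isRenewalTime_of_card_levelSteps_le_one hω (Int.natCast_nonneg h) (by omega) hh2
  choose! ρ hρ using hch
  have hinj : Set.InjOn ρ L := fun h hh h' hh' heq => by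
    have e1 := (hρ h hh).2.2
    have e2 := (hρ h' hh').2.2
    rw [heq] at e1
    exact_mod_cast e1.symm.trans e2
  have hsub : L.image ρ ⊆ (renewalTimes n ω).erase n := fun r hr => by
    obtain ⟨h, hh, rfl⟩ := mem_image.1 hr
    exact mem_erase.2 ⟨(hρ h hh).1.ne, mem_renewalTimes.2 (hρ h hh).2.1⟩
  have hn : n ∈ renewalTimes n ω := mem_renewalTimes.2 (isRenewalTime_self hbr)
  calc #L + 1 = #(L.image ρ) + 1 := by rw [card_image_of_injOn hinj]
    _ ≤ #((renewalTimes n ω).erase n) + 1 := by gcongr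
    _ = #(renewalTimes n ω) := by rw [card_erase_of_mem hn]; have := card_pos.2 ⟨n, hn⟩; omega

open Classical in
/-- Conversely, **renewal times make sparse levels**: `|R_γ| ≤ #{0 ≤ h < y(γ_n) : |V_{h,h+1}| ≤ 1} + 1`
(each renewal time `r < n` gives the level `y(γ_r)`, crossed exactly once). With the previous lemma,
`|R_γ| = #{h : |V_{h,h+1}| = 1} + 1` for every bridge. This is the step "if `|R_γ| ≥ δ' v_n` then
`γ ∈ SAB^{k-1}_{v_n,v,δ'}`" of Case 1 (up to the one top renewal time).
[cite: DuminilCopinHammond2013, proof of Prop. 3.2, Case 1 (arXiv v1, p. 14)] -/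
theorem card_renewalTimes_le_card_sparse_levels_succ (hω : ω ∈ bridges d n) :
    #(renewalTimes n ω) ≤ #((range (ω n 0).toNat).filter fun h : ℕ => #(levelSteps n ω (h : ℤ)) ≤ 1) + 1 := by
  classical
  obtain ⟨hs, hbr⟩ := mem_bridges.1 hω
  have hy0 : ω 0 0 = 0 := by rw [(mem_saws.1 hs).1]; rfl
  have hn : n ∈ renewalTimes n ω := mem_renewalTimes.2 (isRenewalTime_self hbr)
  rw [← card_erase_add_one hn]
  refine Nat.add_le_add_right ?_ 1
  refine card_le_card_of_injOn (fun r => (ω r 0).toNat) (fun r hr => ?_) fun r hr s hs' h => ?_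
  · obtain ⟨hrn, hr⟩ := mem_erase.1 hr
    have hr' := mem_renewalTimes.1 hr
    have hrn' : r < n := lt_of_le_of_ne hr'.1 hrn
    have hlt := apply_lt_apply_of_isRenewalTime hbr hr' (isRenewalTime_self hbr) hrn'
    have hnn : 0 ≤ ω r 0 := by
      rcases Nat.eq_zero_or_pos r with rfl | hr0
      · rw [hy0]
      · rw [← hy0]; exact (hbr r hr0 hr'.1).1.le
    refine mem_filter.2 ⟨mem_range.2 (by show (ω r 0).toNat < (ω n 0).toNat; omega), ?_⟩
    show #(levelSteps n ω (((ω r 0).toNat : ℕ) : ℤ)) ≤ 1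
    rw [Int.toNat_of_nonneg hnn, levelSteps_eq_singleton_of_isRenewalTime hω hr' hrn', card_singleton]
  · have hr' := mem_renewalTimes.1 (mem_erase.1 hr).2
    have hs'' := mem_renewalTimes.1 (mem_erase.1 hs').2
    have h1 : 0 ≤ ω r 0 := by
      rcases Nat.eq_zero_or_pos r with rfl | hr0
      · rw [hy0]
      · rw [← hy0]; exact (hbr r hr0 hr'.1).1.le
    have h2 : 0 ≤ ω s 0 := by
      rcases Nat.eq_zero_or_pos s with rfl | hs0
      · rw [hy0]
      · rw [← hy0]; exact (hbr s hs0 hs''.1).1.le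
    have heq : ω r 0 = ω s 0 := by
      have h' : (ω r 0).toNat = (ω s 0).toNat := h
      rw [← Int.toNat_of_nonneg h1, ← Int.toNat_of_nonneg h2, h']
    exact injOn_apply_renewalTimes hbr (mem_erase.1 hr).2 (mem_erase.1 hs').2 heq

end Levels


/-! ### The level lemma behind (3.4): unfolding all zigzags makes every multiply-crossed level sparser -/

section LevelLemma

variable {n : ℕ} {ω : ℕ → Site d}

/-- Last argmax of an integer sequence on an interval `[a, b]`. [cite: DuminilCopinHammond2013, §3 (definition of a zigzag: last argmax / last argmin, arXiv v1, p. 12)] -/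
theorem exists_last_argmax (f : ℕ → ℤ) {a b : ℕ} (hab : a ≤ b) :
    ∃ i, a ≤ i ∧ i ≤ b ∧ (∀ k, a ≤ k → k ≤ b → f k ≤ f i) ∧ (∀ k, i < k → k ≤ b → f k < f i) := by
  classical
  have hne : (Finset.Icc a b).Nonempty := ⟨a, Finset.mem_Icc.2 ⟨le_rfl, hab⟩⟩
  obtain ⟨k₀, hk₀, hk₀eq⟩ := Finset.exists_mem_eq_sup' hne f
  have hS : ((Finset.Icc a b).filter fun k => f k = (Finset.Icc a b).sup' hne f).Nonempty :=
    ⟨k₀, mem_filter.2 ⟨hk₀, hk₀eq.symm⟩⟩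
  have hi := Finset.max'_mem _ hS
  set i := ((Finset.Icc a b).filter fun k => f k = (Finset.Icc a b).sup' hne f).max' hS
  rw [mem_filter, Finset.mem_Icc] at hi
  refine ⟨i, hi.1.1, hi.1.2, fun k hk1 hk2 => ?_, fun k hk1 hk2 => ?_⟩
  · rw [hi.2]; exact Finset.le_sup' f (Finset.mem_Icc.2 ⟨hk1, hk2⟩)
  · have hle : f k ≤ (Finset.Icc a b).sup' hne f := Finset.le_sup' f (Finset.mem_Icc.2 ⟨by omega, hk2⟩)
    rw [hi.2]
    refine lt_of_le_of_ne hle fun heq => ?_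
    have : k ≤ i := Finset.le_max' _ _ (mem_filter.2 ⟨Finset.mem_Icc.2 ⟨by omega, hk2⟩, heq⟩)
    omega

/-- Last argmin of an integer sequence on an interval `[a, b]`. [cite: DuminilCopinHammond2013, §3 (definition of a zigzag: last argmax / last argmin, arXiv v1, p. 12)] -/
theorem exists_last_argmin (f : ℕ → ℤ) {a b : ℕ} (hab : a ≤ b) :
    ∃ j, a ≤ j ∧ j ≤ b ∧ (∀ k, a ≤ k → k ≤ b → f j ≤ f k) ∧ (∀ k, j < k → k ≤ b → f j < f k) := by
  obtain ⟨j, h1, h2, h3, h4⟩ := exists_last_argmax (fun k => -f k) hab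
  exact ⟨j, h1, h2, fun k hk1 hk2 => neg_le_neg_iff.1 (h3 k hk1 hk2),
    fun k hk1 hk2 => neg_lt_neg_iff.1 (h4 k hk1 hk2)⟩

/-- Any time `≤ n` at height `≤ ℓ` is at most `lastBelow`. [cite: MadrasSlade1993, §3.1 (proof of Proposition 3.1.5)] -/
theorem le_lastBelow {ξ : ℕ → Site d} {ℓ : ℤ} {i : ℕ} (hi : i ≤ n) (h : ξ i 0 ≤ ℓ) :
    i ≤ lastBelow n ξ ℓ := by
  classical
  have hmem : i ∈ (range (n + 1)).filter fun i => ξ i 0 ≤ ℓ :=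
    mem_filter.2 ⟨mem_range.2 (Nat.lt_succ_of_le hi), h⟩
  rw [lastBelow, dif_pos ⟨i, hmem⟩]
  exact Finset.le_max' _ _ hmem

/-- A zigzag whose point of zig is at most the last time `t` below a level has its point of zag `≤ t`
as well (a zigzag never straddles such a `t`). [cite: DuminilCopinHammond2013, §3 (zigzags)] -/
theorem IsZigzag.zag_le_of_zig_le {i j t : ℕ} (hz : IsZigzag n ω i j) (ht : t ≤ n)
    (hafter : ∀ k, t < k → k ≤ n → ω t 0 < ω k 0) (hit : i ≤ t) : j ≤ t := by
  by_contra hjt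
  exact absurd (hz.zag_le_apply hit ht) (not_le.2 (hafter j (not_le.1 hjt) hz.le_n))

/-- **The zigzag built from a multiply-visited level**: if the walk is above `h` at some time `s` no later
than the last time `t` at height `≤ h`, then the last argmax `i` of the height on `[1, t]` and the last
argmin `j` of the height on `[i, n]` form a zigzag with `j ≤ t` and `y_j ≤ h < y_i`.
[cite: DuminilCopinHammond2013, proof of Prop. 3.2, Case 2 (arXiv v1, p. 14), made explicit] -/
theorem exists_zigzag_of_visit_above (hy0 : ω 0 0 = 0) {h : ℤ} (h0 : 0 ≤ h) {t : ℕ}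
    (ht : t ≤ n) (hyt : ω t 0 ≤ h) (hafter : ∀ k, t < k → k ≤ n → h < ω k 0) {s : ℕ} (hs : s ≤ t)
    (hys : h < ω s 0) :
    ∃ i j, IsZigzag n ω i j ∧ j ≤ t ∧ 1 ≤ i ∧ ω j 0 ≤ h ∧ h < ω i 0 := by
  have hs1 : 1 ≤ s := by
    rcases Nat.eq_zero_or_pos s with rfl | hs0
    · rw [hy0] at hys; omega
    · exact hs0
  obtain ⟨i, hi1, hit, himax, histrict⟩ := exists_last_argmax (fun k => ω k 0) (hs1.trans hs)
  have hin : i ≤ n := hit.trans ht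
  obtain ⟨j, hij, hjn, hjmin, hjstrict⟩ := exists_last_argmin (fun k => ω k 0) hin
  have hyi : h < ω i 0 := hys.trans_le (himax s hs1 hs)
  have hyj : ω j 0 ≤ h := (hjmin t hit ht).trans hyt
  have hjt : j ≤ t := by
    by_contra hlt
    exact absurd hyj (not_le.2 (hafter j (not_le.1 hlt) hjn))
  refine ⟨i, j, ⟨hij, hjn, fun _ => hi1, fun k hk1 hk2 => himax k hk1 (hk2.trans hjt),
    fun k hk1 hk2 => histrict k hk1 (hk2.trans hjt), hjmin, hjstrict⟩, hjt, hi1, hyj, hyi⟩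

open Classical in
/-- The shift of the level built over `h` when all zigzags are unfolded: the total translation
`Σ 2 (y_i - y_j)` over the zigzags `(i, j)` lying entirely at or before the last time at height `≤ h`.
[cite: DuminilCopinHammond2013, proof of Prop. 3.2, Case 2, inclusion (3.4)/"equnfinc" (arXiv v1, p. 14)] -/
def levelShift (n : ℕ) (ω : ℕ → Site d) (h : ℤ) : ℤ :=
  ∑ z ∈ (zigzags n ω).filter (fun z => z.2 ≤ lastBelow n ω h), 2 * (ω z.1 0 - ω z.2 0)

/-- `levelShift ≥ 0`. [cite: DuminilCopinHammond2013, proof of Prop. 3.2, Case 2] -/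
theorem levelShift_nonneg (n : ℕ) (ω : ℕ → Site d) (h : ℤ) : 0 ≤ levelShift n ω h :=
  sum_nonneg fun z hz => by have := (mem_zigzags.1 (mem_filter.1 hz).1).zag_le_zig; omega

/-- `levelShift` is monotone in the level. [cite: DuminilCopinHammond2013, proof of Prop. 3.2, Case 2] -/
theorem levelShift_mono (hy0 : ω 0 0 = 0) {h h' : ℤ} (h0 : 0 ≤ h) (hhh : h ≤ h') :
    levelShift n ω h ≤ levelShift n ω h' := by
  classical
  unfold levelShift
  refine sum_le_sum_of_subset_of_nonneg (fun z hz => ?_) fun z hz _ => by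
    have := (mem_zigzags.1 (mem_filter.1 hz).1).zag_le_zig; omega
  rw [mem_filter] at hz ⊢
  refine ⟨hz.1, hz.2.trans ?_⟩
  obtain ⟨htn, hyt, -⟩ := lastBelow_spec (ξ := ω) (ℓ := h) ⟨0, Nat.zero_le _, by rw [hy0]; exact h0⟩
  exact le_lastBelow htn (hyt.trans hhh)

/-- `levelShift` is at most the total shift, so the shifted level stays below the new top:
`h + levelShift h < y(Unf_{Z(γ)}(γ)_n)` for `h < y(γ_n)`. [cite: DuminilCopinHammond2013, Lemma 3.7] -/
theorem add_levelShift_lt {h : ℤ} (hh : h < ω n 0) :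
    h + levelShift n ω h < unfoldZigzags (zigzags n ω) ω n 0 := by
  classical
  rw [unfoldZigzags_apply_last fun z hz => ⟨(mem_zigzags.1 hz).le, (mem_zigzags.1 hz).le_n⟩]
  have : levelShift n ω h ≤ ∑ z ∈ zigzags n ω, 2 * (ω z.1 0 - ω z.2 0) :=
    sum_le_sum_of_subset_of_nonneg (filter_subset _ _) fun z hz _ => by
      have := (mem_zigzags.1 hz).zag_le_zig; omega
  omega

/-- **Shift along the segment over a level.** With `t` the last time at height `≤ h` and `a` the last
point of zag `≤ t`, the shift of `Unf_{Z(γ)}` is constant, equal to `levelShift h`, at every time of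
`[a, t + 1]`. [cite: DuminilCopinHammond2013, proof of Prop. 3.2, Case 2 (arXiv v1, p. 14), made explicit] -/
theorem zigzagsShift_zigzags_eq_levelShift (hω : ω ∈ bridges d n) {h : ℤ} (h0 : 0 ≤ h) {a : ℕ}
    (ha : ∀ z ∈ zigzags n ω, z.2 ≤ lastBelow n ω h → z.2 ≤ a) {k : ℕ} (hak : a ≤ k)
    (hkt : k ≤ lastBelow n ω h + 1) : zigzagsShift (zigzags n ω) ω k = levelShift n ω h := by
  classical
  obtain ⟨hs, hbr⟩ := mem_bridges.1 hω
  have hy0 : ω 0 0 = 0 := by rw [(mem_saws.1 hs).1]; rfl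
  obtain ⟨htn, -, hafter⟩ := lastBelow_spec (ξ := ω) (ℓ := h) ⟨0, Nat.zero_le _, by rw [hy0]; exact h0⟩
  set t := lastBelow n ω h
  have hafter' : ∀ k, t < k → k ≤ n → ω t 0 < ω k 0 := fun k hk hkn =>
    lt_of_le_of_lt (lastBelow_spec (ξ := ω) (ℓ := h) ⟨0, Nat.zero_le _, by rw [hy0]; exact h0⟩).2.1
      (hafter k hk hkn)
  rw [levelShift, sum_filter, zigzagsShift]
  refine sum_congr rfl fun z hz => ?_
  obtain ⟨i', j'⟩ := z
  have hzz := mk_mem_zigzags.1 hz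
  simp only
  by_cases hjt : j' ≤ t
  · have hja : j' ≤ a := ha (i', j') hz hjt
    rw [if_pos hjt]
    rcases (hja.trans hak).eq_or_lt with heq | hlt
    · subst heq
      rw [if_neg (lt_irrefl _)]
      rcases hzz.le.eq_or_lt with heq' | hlt'
      · subst heq'; simp
      · rw [if_pos ⟨hlt', le_rfl⟩]; ring
    · rw [if_pos hlt, if_neg (by omega)]; ring
  · have hit : t < i' := by
      by_contra hle
      exact hjt (hzz.zag_le_of_zig_le htn hafter' (not_lt.1 hle))
    rw [if_neg hjt, if_neg (by omega), if_neg (by omega)]; ring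

/-- After the last time `t` at height `≤ h`, the heights of `Unf_{Z(γ)}(γ)` are at least
`h + 1 + levelShift h` (every later shift contains the shift at `t`, and reflection terms are
non-negative). [cite: DuminilCopinHammond2013, proof of Prop. 3.2, Case 2, made explicit] -/
theorem add_levelShift_lt_unfoldZigzags_apply (hω : ω ∈ bridges d n) {h : ℤ} (h0 : 0 ≤ h) {k : ℕ}
    (htk : lastBelow n ω h < k) (hkn : k ≤ n) :
    h + levelShift n ω h + 1 ≤ unfoldZigzags (zigzags n ω) ω k 0 := by
  classical
  obtain ⟨hs, hbr⟩ := mem_bridges.1 hω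
  have hy0 : ω 0 0 = 0 := by rw [(mem_saws.1 hs).1]; rfl
  obtain ⟨htn, -, hafter⟩ := lastBelow_spec (ξ := ω) (ℓ := h) ⟨0, Nat.zero_le _, by rw [hy0]; exact h0⟩
  have hyk : h < ω k 0 := hafter k htk hkn
  rw [unfoldZigzags_apply_zero]
  have : levelShift n ω h ≤ zigzagsShift (zigzags n ω) ω k := by
    rw [levelShift, sum_filter, zigzagsShift]
    refine sum_le_sum fun z hz => ?_
    have hzz := mem_zigzags.1 hz
    have hD := hzz.zag_le_zig
    have hc : z.1 < k → k ≤ z.2 → ω k 0 ≤ ω z.1 0 := fun h1 h2 => hzz.apply_le_zig (by omega) h2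
    split_ifs <;> omega
  omega

open Classical in
/-- **The crossings of the shifted level are exactly the late crossings of the old one.** With `t` the
last time at height `≤ h`, `S = levelShift h` and `a ≤ t` a renewal time of `W = Unf_{Z(γ)}(γ)` after
which no zigzag with zag `≤ t` ends, the steps of `W` between the levels `h + S`, `h + S + 1` are the
steps of `γ` between `h`, `h + 1` taken at times `≥ a`.
[cite: DuminilCopinHammond2013, proof of Prop. 3.2, Case 2, inclusion (3.4) (arXiv v1, p. 14), made explicit] -/
theorem levelSteps_unfoldZigzags_eq_filter (hω : ω ∈ bridges d n) {h : ℤ} (h0 : 0 ≤ h) (hh : h < ω n 0)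
    {a : ℕ} (hat : a ≤ lastBelow n ω h)
    (ha : ∀ z ∈ zigzags n ω, z.2 ≤ lastBelow n ω h → z.2 ≤ a)
    (haR : IsRenewalTime n (unfoldZigzags (zigzags n ω) ω) a) :
    levelSteps n (unfoldZigzags (zigzags n ω) ω) (h + levelShift n ω h) =
      (levelSteps n ω h).filter fun k => a ≤ k := by
  classical
  obtain ⟨hs, hbr⟩ := mem_bridges.1 hω
  have hy0 : ω 0 0 = 0 := by rw [(mem_saws.1 hs).1]; rfl
  obtain ⟨htn, hyt, hafter⟩ := lastBelow_spec (ξ := ω) (ℓ := h) ⟨0, Nat.zero_le _, by rw [hy0]; exact h0⟩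
  set t := lastBelow n ω h with htdef
  set W := unfoldZigzags (zigzags n ω) ω with hWdef
  set S := levelShift n ω h with hSdef
  have hWbr : IsBridge n W := (mem_bridges.1 (unfoldZigzags_mem_bridges hω Subset.rfl)).2
  have htn' : t < n := lt_of_le_of_ne htn fun heq => by rw [heq] at hyt; omega
  -- heights of `W` on `[a, t+1]` and after `t`
  have hseg : ∀ k, a ≤ k → k ≤ t + 1 → W k 0 = ω k 0 + S := fun k hk1 hk2 => by
    rw [hWdef, unfoldZigzags_apply_zero, zigzagsShift_zigzags_eq_levelShift hω h0 ha hk1 hk2]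
  have hlate : ∀ k, t < k → k ≤ n → h + S + 1 ≤ W k 0 := fun k hk1 hk2 =>
    add_levelShift_lt_unfoldZigzags_apply hω h0 hk1 hk2
  have haR' := (isRenewalTime_iff_heights hWbr haR.1).1 haR
  have hWa : W a 0 ≤ h + S := by
    rcases hat.eq_or_lt with heq | hlt
    · rw [heq, hseg t hat (Nat.le_succ t)]; omega
    · have h1 := haR'.2 t hlt htn
      rw [hseg t hat (Nat.le_succ t)] at h1; omega
  ext k
  rw [mem_levelSteps, mem_filter, mem_levelSteps]
  constructor
  · rintro ⟨hkn, hpred⟩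
    -- `k ≥ a`: before `a` everything is `≤ W a ≤ h + S`
    have hak : a ≤ k := by
      by_contra hlt
      have h1 := haR'.1 k (by omega)
      have h2 := haR'.1 (k + 1) (by omega)
      omega
    -- `k ≤ t`: after `t` everything is `≥ h + S + 1`
    have hkt : k ≤ t := by
      by_contra hlt
      have h1 := hlate k (by omega) hkn.le
      have h2 := hlate (k + 1) (by omega) hkn
      omega
    have e1 := hseg k hak (by omega)
    have e2 := hseg (k + 1) (by omega) (by omega)
    refine ⟨⟨hkn, ?_⟩, hak⟩
    omega
  · rintro ⟨⟨hkn, hpred⟩, hak⟩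
    have hkt : k ≤ t := by
      by_contra hlt
      have h1 := hafter k (by omega) hkn.le
      have h2 := hafter (k + 1) (by omega) hkn
      omega
    have e1 := hseg k hak (by omega)
    have e2 := hseg (k + 1) (by omega) (by omega)
    refine ⟨hkn, ?_⟩
    omega

open Classical in
/-- **The level lemma (Δ3), one level at a time.** For a bridge `γ` and a level `0 ≤ h < y(γ_n)`, the
level `h + levelShift h` of `W = Unf_{Z(γ)}(γ)` (all zigzags unfolded) is crossed at least once, and at
most `max(1, |V_{h,h+1}(γ)| - 2)` times: when `|V_{h,h+1}(γ)| ≥ 2` the zigzag built from `h` crosses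
it once on its initial piece and once on its central section, and both crossings disappear.
[cite: DuminilCopinHammond2013, proof of Prop. 3.2, Case 2, inclusion (3.4)/"equnfinc" (arXiv v1, p. 14): "the value of |V_{h,h+1}| (with the value of h updated) will drop by at least two"] -/
theorem card_levelSteps_unfoldZigzags_le (hω : ω ∈ bridges d n) {h : ℤ} (h0 : 0 ≤ h) (hh : h < ω n 0) :
    1 ≤ #(levelSteps n (unfoldZigzags (zigzags n ω) ω) (h + levelShift n ω h)) ∧
      #(levelSteps n (unfoldZigzags (zigzags n ω) ω) (h + levelShift n ω h)) ≤
        max 1 (#(levelSteps n ω h) - 2) := by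
  classical
  obtain ⟨hs, hbr⟩ := mem_bridges.1 hω
  obtain ⟨hω0, -, hadj, -⟩ := mem_saws.1 hs
  have hy0 : ω 0 0 = 0 := by rw [hω0]; rfl
  obtain ⟨htn, hyt, hafter⟩ := lastBelow_spec (ξ := ω) (ℓ := h) ⟨0, Nat.zero_le _, by rw [hy0]; exact h0⟩
  set t := lastBelow n ω h with htdef
  have htn' : t < n := lt_of_le_of_ne htn fun heq => by rw [heq] at hyt; omega
  have hafter' : ∀ k, t < k → k ≤ n → ω t 0 < ω k 0 := fun k hk hkn => lt_of_le_of_lt hyt (hafter k hk hkn)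
  -- `a` := the last point of zag `≤ t` (exists: `(0,0)` is a zigzag)
  set A := (zigzags n ω).filter fun z => z.2 ≤ t with hAdef
  have hAne : A.Nonempty := ⟨(0, 0), mem_filter.2 ⟨mk_mem_zigzags.2 (isZigzag_zero hbr), Nat.zero_le _⟩⟩
  obtain ⟨za, hzaA, hza⟩ := Finset.exists_mem_eq_sup A hAne Prod.snd
  set a := A.sup Prod.snd with hadef
  have ha : ∀ z ∈ zigzags n ω, z.2 ≤ t → z.2 ≤ a := fun z hz hzt => by
    rw [hadef]; exact Finset.le_sup (f := Prod.snd) (mem_filter.2 ⟨hz, hzt⟩)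
  obtain ⟨hzaZ, hzat⟩ := mem_filter.1 hzaA
  have hat : a ≤ t := by rw [hza]; exact hzat
  have haR : IsRenewalTime n (unfoldZigzags (zigzags n ω) ω) a := by
    rw [hza]; exact ((unfoldZigzags_spec hω Subset.rfl).2.2.2.1 za hzaZ).2
  have hfilter := levelSteps_unfoldZigzags_eq_filter hω h0 hh hat ha haR
  rw [hfilter]
  -- the step at `t` is a late crossing
  have hstep := step_up_eq (hadj t htn') hyt (hafter (t + 1) (Nat.lt_succ_self t) htn')
  have htV : t ∈ (levelSteps n ω h).filter fun k => a ≤ k :=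
    mem_filter.2 ⟨mem_levelSteps.2 ⟨htn', Or.inl hstep⟩, hat⟩
  refine ⟨card_pos.2 ⟨t, htV⟩, ?_⟩
  -- every crossing happens at a time `≤ t`
  have hVle : ∀ k ∈ levelSteps n ω h, k ≤ t := fun k hk => by
    obtain ⟨hkn, hpred⟩ := mem_levelSteps.1 hk
    by_contra hlt
    have h1 := hafter k (by omega) hkn.le
    have h2 := hafter (k + 1) (by omega) hkn
    omega
  by_cases hV : #(levelSteps n ω h) ≤ 1
  · calc #((levelSteps n ω h).filter fun k => a ≤ k) ≤ #(levelSteps n ω h) := card_filter_le _ _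
      _ ≤ max 1 (#(levelSteps n ω h) - 2) := hV.trans (le_max_left _ _)
  · -- a second crossing `k₀ < t` gives a visit above `h` before `t`, hence the zigzag built from `h`
    rw [not_le] at hV
    obtain ⟨k₀, hk₀, hk₀t⟩ : ∃ k₀ ∈ levelSteps n ω h, k₀ ≠ t := by
      by_contra hno
      push Not at hno
      have : levelSteps n ω h ⊆ {t} := fun k hk => mem_singleton.2 (hno k hk)
      have := card_le_card this
      rw [card_singleton] at this
      omega
    have hk₀t' : k₀ < t := lt_of_le_of_ne (hVle k₀ hk₀) hk₀t
    obtain ⟨hk₀n, hpred₀⟩ := mem_levelSteps.1 hk₀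
    -- a time `s ≤ t` with `y_s = h + 1`
    obtain ⟨s, hst, hys⟩ : ∃ s, s ≤ t ∧ h < ω s 0 := by
      rcases hpred₀ with ⟨-, h2⟩ | ⟨h1, -⟩
      · exact ⟨k₀ + 1, by omega, by omega⟩
      · exact ⟨k₀, by omega, by omega⟩
    obtain ⟨i, j, hz, hjt, hi1, hyj, hyi⟩ :=
      exists_zigzag_of_visit_above hy0 h0 htn hyt hafter hst hys
    have hja : j ≤ a := ha (i, j) (mk_mem_zigzags.2 hz) hjt
    -- crossing on the initial piece `[0, i)` and on the central section `[i, j)`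
    obtain ⟨k₁, hk₁i, hk₁a, hk₁b⟩ := exists_step_up hadj hz.fst_le_n (by rw [hy0]; exact h0) hyi
    obtain ⟨k₂, hik₂, hk₂j, hk₂a, hk₂b⟩ := exists_step_down hadj hz.le hz.le_n hyi hyj
    have hk₁V : k₁ ∈ levelSteps n ω h := mem_levelSteps.2 ⟨by have := hz.fst_le_n; omega, Or.inl ⟨hk₁a, hk₁b⟩⟩
    have hk₂V : k₂ ∈ levelSteps n ω h := mem_levelSteps.2 ⟨by have := hz.le_n; omega, Or.inr ⟨hk₂a, hk₂b⟩⟩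
    have hne : k₁ ≠ k₂ := by omega
    have hsub : ((levelSteps n ω h).filter fun k => a ≤ k) ∪ {k₁, k₂} ⊆ levelSteps n ω h := by
      intro k hk
      rcases mem_union.1 hk with hk | hk
      · exact (mem_filter.1 hk).1
      · rcases mem_insert.1 hk with rfl | hk
        · exact hk₁V
        · rw [mem_singleton] at hk; subst hk; exact hk₂V
    have hdisj : Disjoint ((levelSteps n ω h).filter fun k => a ≤ k) {k₁, k₂} := by
      rw [Finset.disjoint_left]
      intro k hk hk'
      have := (mem_filter.1 hk).2
      rcases mem_insert.1 hk' with rfl | hk'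
      · omega
      · rw [mem_singleton] at hk'; omega
    have := card_le_card hsub
    rw [card_union_of_disjoint hdisj, card_pair hne] at this
    calc #((levelSteps n ω h).filter fun k => a ≤ k) ≤ #(levelSteps n ω h) - 2 := by omega
      _ ≤ max 1 (#(levelSteps n ω h) - 2) := le_max_right _ _

open Classical in
/-- **The level lemma (Δ3), counted — the inclusion (3.4) `Unf_{Z(γ)}(SAB^k_{n,v,δ}) ⊆ SAB^{k-1}_{n,v,δ}`
in the tree's level-count vocabulary.** For a bridge `γ` and `W = Unf_{Z(γ)}(γ)`, the strictly increasing
map `h ↦ h + levelShift h` sends the levels `0 ≤ h < y(γ_n)` with `|V_{h,h+1}(γ)| ≤ m` to levels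
`0 ≤ h' < y(W_n)` with `|V_{h',h'+1}(W)| ≤ max(1, m - 2)`; hence the count of the latter is at least the
count of the former. (The printed mechanism "the successive unfoldings leave `V_{h,h+1}` unchanged
except for changing the value of `h` …" is realised by this explicit injection.)
[cite: DuminilCopinHammond2013, proof of Prop. 3.2, Case 2, inclusion (3.4)/"equnfinc" (arXiv v1, p. 14)] -/
theorem card_sparse_levels_le_card_sparse_levels_unfoldZigzags (hω : ω ∈ bridges d n) (m : ℕ) :
    #((range (ω n 0).toNat).filter fun h : ℕ => #(levelSteps n ω (h : ℤ)) ≤ m) ≤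
      #((range (unfoldZigzags (zigzags n ω) ω n 0).toNat).filter fun h : ℕ =>
        #(levelSteps n (unfoldZigzags (zigzags n ω) ω) (h : ℤ)) ≤ max 1 (m - 2)) := by
  classical
  obtain ⟨hs, hbr⟩ := mem_bridges.1 hω
  have hy0 : ω 0 0 = 0 := by rw [(mem_saws.1 hs).1]; rfl
  refine card_le_card_of_injOn (fun h : ℕ => ((h : ℤ) + levelShift n ω h).toNat) (fun h hh => ?_)
    fun h hh h' hh' heq => ?_
  · obtain ⟨hh1, hh2⟩ := mem_filter.1 hh
    rw [mem_range] at hh1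
    have h0 : (0 : ℤ) ≤ (h : ℤ) := Int.natCast_nonneg h
    have hhn : (h : ℤ) < ω n 0 := by omega
    have hS := levelShift_nonneg n ω (h : ℤ)
    have hlt := add_levelShift_lt hhn
    obtain ⟨-, hle⟩ := card_levelSteps_unfoldZigzags_le hω h0 hhn
    refine mem_filter.2 ⟨mem_range.2 ?_, ?_⟩
    · show ((h : ℤ) + levelShift n ω h).toNat < (unfoldZigzags (zigzags n ω) ω n 0).toNat
      omega
    · show #(levelSteps n (unfoldZigzags (zigzags n ω) ω) ((((h : ℤ) + levelShift n ω h).toNat : ℕ) : ℤ)) ≤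
        max 1 (m - 2)
      rw [Int.toNat_of_nonneg (by omega)]
      refine hle.trans (max_le_max le_rfl ?_)
      omega
  · -- strictly increasing, hence injective
    have key : ∀ {h h' : ℕ}, h ∈ (range (ω n 0).toNat).filter (fun h : ℕ => #(levelSteps n ω (h : ℤ)) ≤ m) →
        h < h' → ((h : ℤ) + levelShift n ω h).toNat < ((h' : ℤ) + levelShift n ω h').toNat := by
      intro h h' hh hlt
      have h0 : (0 : ℤ) ≤ (h : ℤ) := Int.natCast_nonneg h
      have hmono := levelShift_mono (n := n) hy0 h0 (show (h : ℤ) ≤ (h' : ℤ) by exact_mod_cast hlt.le)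
      have hS := levelShift_nonneg n ω (h : ℤ)
      omega
    by_contra hne
    rcases lt_or_gt_of_ne hne with hlt | hlt
    · exact absurd heq (key hh hlt).ne
    · exact absurd heq.symm (key hh' hlt).ne

open Classical in
/-- **(3.4) as printed, for `k ≥ 2`**: `#{h : |V_{h,h+1}(γ)| ≤ k} ≤ #{h' : |V_{h',h'+1}(Unf_{Z(γ)}γ)| ≤ k - 1}`
(levels `0 ≤ h < y(·_n)`), i.e. `Unf_{Z(γ)}` maps `SAB^k_{n,v,δ}` into `SAB^{k-1}_{n,v,δ}` (the endpoint
only rises, Lemma 3.7). [cite: DuminilCopinHammond2013, proof of Prop. 3.2, Case 2, (3.4) (arXiv v1, p. 14)] -/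
theorem card_sparse_levels_le_card_sparse_levels_unfoldZigzags_pred (hω : ω ∈ bridges d n) {k : ℕ}
    (hk : 2 ≤ k) :
    #((range (ω n 0).toNat).filter fun h : ℕ => #(levelSteps n ω (h : ℤ)) ≤ k) ≤
      #((range (unfoldZigzags (zigzags n ω) ω n 0).toNat).filter fun h : ℕ =>
        #(levelSteps n (unfoldZigzags (zigzags n ω) ω) (h : ℤ)) ≤ k - 1) := by
  classical
  refine (card_sparse_levels_le_card_sparse_levels_unfoldZigzags hω k).trans (card_le_card ?_)
  intro h hh
  rw [mem_filter] at hh ⊢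
  refine ⟨hh.1, hh.2.trans ?_⟩
  omega

end LevelLemma


/-! ### The two reconstruction injections of the proof of Proposition 3.2 (multi-valued map principle, Cases 2 and 3) -/

section MultiValued

variable {n : ℕ} {ω : ℕ → Site d}

/-- `Z(γ) ⊆ [0, n]²`. [cite: DuminilCopinHammond2013, §3 (zigzags, arXiv v1, p. 12)] -/
theorem zigzags_subset_product (n : ℕ) (ω : ℕ → Site d) :
    zigzags n ω ⊆ range (n + 1) ×ˢ range (n + 1) := by
  classical
  intro z hz
  rw [zigzags] at hz
  exact (mem_filter.1 hz).1

/-- **Case 2 reconstruction**: a bridge all of whose zigzags were unfolded is recovered from the image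
and its set of zigzags ("to determine `γ`, it is enough to know the … unfolded points of zig and of zag"),
i.e. `γ ↦ Z(γ)` is injective on each fibre of `γ ↦ Unf_{Z(γ)}(γ)`.
[cite: DuminilCopinHammond2013, proof of Prop. 3.2, Case 2, display (3.5)/"equnfclaim" (arXiv v1, pp. 14–15)] -/
theorem injOn_zigzags_of_unfoldZigzags_eq (n : ℕ) (φ : ℕ → Site d) :
    Set.InjOn (fun γ : ℕ → Site d => zigzags n γ) {γ | unfoldZigzags (zigzags n γ) γ = φ} := by
  intro γ hγ γ' hγ' h
  simp only [Set.mem_setOf_eq] at hγ hγ' h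
  have h1 := unfoldZigzags_unfoldZigzags (ω := γ) (zigzagAdmissible_of_subset (Subset.refl (zigzags n γ)))
  have h2 := unfoldZigzags_unfoldZigzags (ω := γ') (zigzagAdmissible_of_subset (Subset.refl (zigzags n γ')))
  rw [hγ] at h1
  rw [hγ'] at h2
  rw [← h1, h, h2]

/-- **Case 2 preimage bound**, structural form: any family `S` of walks with at most `m` zigzags each,
all unfolding (all zigzags at once) to the same `φ`, has at most as many members as there are sets of at
most `m` pairs in `[0, n]²`. (The printed bound `binom(u_n, 2ε_n u_n)` counts the SET of zig/zag points,
which does not determine the pairing when degenerate pairs occur; counting pair-sets keeps the order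
`e^{O(ε log(1/ε)) n}`.) [cite: DuminilCopinHammond2013, proof of Prop. 3.2, Case 2, display (3.5) (arXiv v1, pp. 14–15)] -/
theorem card_le_of_unfoldZigzags_all_eq (n : ℕ) (φ : ℕ → Site d) (m : ℕ) {S : Finset (ℕ → Site d)}
    (hS : ∀ γ ∈ S, #(zigzags n γ) ≤ m ∧ unfoldZigzags (zigzags n γ) γ = φ) :
    #S ≤ #(((range (n + 1) ×ˢ range (n + 1)).powerset).filter fun Z => #Z ≤ m) := by
  refine card_le_card_of_injOn (t := ((range (n + 1) ×ˢ range (n + 1)).powerset).filter fun Z => #Z ≤ m)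
    (fun γ => zigzags n γ) (fun γ hγ => ?_) fun γ hγ γ' hγ' h => ?_
  · have h1 := (hS γ (Finset.mem_coe.1 hγ)).1
    exact Finset.mem_coe.2 (mem_filter.2 ⟨mem_powerset.2 (zigzags_subset_product n γ), h1⟩)
  · exact injOn_zigzags_of_unfoldZigzags_eq n φ (hS γ (Finset.mem_coe.1 hγ)).2
      (hS γ' (Finset.mem_coe.1 hγ')).2 h

open Classical in
/-- The candidate pairs for reconstructing an unfolded family of short zigzags from its image `φ`:
pairs `(i, j)` with `i` a renewal time of `φ`, `i < j ≤ n` and `j - i ≤ L` ("the number of possibilities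
for the point of zag given the point of zig is bounded by `⌈1/δ'⌉`").
[cite: DuminilCopinHammond2013, proof of Prop. 3.2, Case 3 (arXiv v1, pp. 15–16)] -/
def shortPairsAt (n : ℕ) (φ : ℕ → Site d) (L : ℕ) : Finset (ℕ × ℕ) :=
  (renewalTimes n φ ×ˢ range (n + 1)).filter fun p => p.1 < p.2 ∧ p.2 - p.1 ≤ L

/-- `#shortPairsAt ≤ |R_φ| · L`. [cite: DuminilCopinHammond2013, proof of Prop. 3.2, Case 3 (arXiv v1, pp. 15–16)] -/
theorem card_shortPairsAt_le (n : ℕ) (φ : ℕ → Site d) (L : ℕ) :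
    #(shortPairsAt n φ L) ≤ #(renewalTimes n φ) * L := by
  classical
  calc #(shortPairsAt n φ L)
      ≤ #((renewalTimes n φ ×ˢ Finset.Icc 1 L).image fun p : ℕ × ℕ => (p.1, p.1 + p.2)) :=
        card_le_card fun p hp => by
          obtain ⟨hp, h1, h2⟩ := mem_filter.1 hp
          rw [mem_product] at hp
          refine mem_image.2 ⟨(p.1, p.2 - p.1), mem_product.2 ⟨hp.1, Finset.mem_Icc.2 ⟨by omega, h2⟩⟩, ?_⟩
          exact Prod.ext rfl (show p.1 + (p.2 - p.1) = p.2 by omega)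
    _ ≤ #(renewalTimes n φ ×ˢ Finset.Icc 1 L) := card_image_le
    _ = #(renewalTimes n φ) * L := by rw [card_product, Nat.card_Icc]; simp

/-- **Case 3 reconstruction data**: every unfolded short non-degenerate zigzag of `γ` is a candidate pair of
the image (its point of zig is a renewal time of `Unf_Z(γ)`, Lemma 3.5 (1)).
[cite: DuminilCopinHammond2013, proof of Prop. 3.2, Case 3 (arXiv v1, pp. 15–16)] -/
theorem subset_shortPairsAt_unfoldZigzags (hω : ω ∈ bridges d n) {Z : Finset (ℕ × ℕ)}
    (hZ : Z ⊆ zigzags n ω) {L : ℕ} (hsh : ∀ z ∈ Z, z.1 < z.2 ∧ z.2 - z.1 ≤ L) :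
    Z ⊆ shortPairsAt n (unfoldZigzags Z ω) L := by
  classical
  intro z hz
  have hR := ((unfoldZigzags_spec hω hZ).2.2.2.1 z hz).1
  have hzz := mem_zigzags.1 (hZ hz)
  obtain ⟨h1, h2⟩ := hsh z hz
  exact mem_filter.2 ⟨mem_product.2 ⟨mem_renewalTimes.2 hR, mem_range.2 (Nat.lt_succ_of_le hzz.le_n)⟩, h1, h2⟩

/-- **Case 3 preimage bound**: any family `S` of bridges `γ`, each having some `m`-set `Z` of
non-degenerate zigzags of central length `≤ L` with `Unf_Z(γ) = φ`, has at most `binom(|R_φ| · L, m)`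
members — `γ = Unf_Z(φ)` is determined by `Z`, and `Z` is an `m`-subset of the candidate pairs. (Printed:
`binom(|R_φ|, m) ⌈1/δ'⌉^m`; both give the same quotient in Lemma 3.8.)
[cite: DuminilCopinHammond2013, proof of Prop. 3.2, Case 3, display (3.10)/"eqbackwardentropy" (arXiv v1, p. 16)] -/
theorem card_le_choose_of_unfoldZigzags_eq (n : ℕ) (φ : ℕ → Site d) (L m : ℕ) {S : Finset (ℕ → Site d)}
    (hS : ∀ γ ∈ S, γ ∈ bridges d n ∧ ∃ Z ⊆ zigzags n γ,
      (∀ z ∈ Z, z.1 < z.2 ∧ z.2 - z.1 ≤ L) ∧ #Z = m ∧ unfoldZigzags Z γ = φ) :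
    #S ≤ (#(renewalTimes n φ) * L).choose m := by
  have hch : ∀ γ ∈ S, ∃ Z, Z ⊆ zigzags n γ ∧ (∀ z ∈ Z, z.1 < z.2 ∧ z.2 - z.1 ≤ L) ∧ #Z = m ∧
      unfoldZigzags Z γ = φ := fun γ hγ => by
    obtain ⟨-, Z, hZ, h⟩ := hS γ hγ
    exact ⟨Z, hZ, h⟩
  choose! Zf hZf using hch
  refine (card_le_card_of_injOn (t := (shortPairsAt n φ L).powersetCard m) Zf (fun γ hγ => ?_)
    fun γ hγ γ' hγ' h => ?_).trans ?_
  · have hγ' := Finset.mem_coe.1 hγ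
    obtain ⟨hZ, hsh, hcard, heq⟩ := hZf γ hγ'
    refine Finset.mem_coe.2 (mem_powersetCard.2 ⟨?_, hcard⟩)
    rw [← heq]
    exact subset_shortPairsAt_unfoldZigzags (hS γ hγ').1 hZ hsh
  · obtain ⟨hZ, -, -, heq⟩ := hZf γ (Finset.mem_coe.1 hγ)
    obtain ⟨hZ', -, -, heq'⟩ := hZf γ' (Finset.mem_coe.1 hγ')
    have h1 := unfoldZigzags_unfoldZigzags (ω := γ) (zigzagAdmissible_of_subset hZ)
    have h2 := unfoldZigzags_unfoldZigzags (ω := γ') (zigzagAdmissible_of_subset hZ')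
    rw [heq] at h1
    rw [heq'] at h2
    rw [← h1, h, h2]
  · rw [card_powersetCard]
    exact Nat.choose_le_choose m (card_shortPairsAt_le n φ L)

end MultiValued


/-! ### Index sets: a family of disjoint non-degenerate pairs is determined by its set of endpoints (Case 2 code) -/

section IndexSet

variable {n : ℕ} {ω : ℕ → Site d}

/-- The set of endpoints (points of zig and of zag) of a family of pairs.
[cite: DuminilCopinHammond2013, proof of Prop. 3.2, Case 2 ("the union of the points in the output that correspond to all of the unfolded points of zig and of zag", arXiv v1, p. 15)] -/
def indexSet (Z : Finset (ℕ × ℕ)) : Finset ℕ := Z.image Prod.fst ∪ Z.image Prod.snd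

/-- Membership in `indexSet`. [cite: DuminilCopinHammond2013, proof of Prop. 3.2, Case 2] -/
theorem mem_indexSet {Z : Finset (ℕ × ℕ)} {x : ℕ} : x ∈ indexSet Z ↔ ∃ z ∈ Z, z.1 = x ∨ z.2 = x := by
  simp only [indexSet, mem_union, mem_image]
  constructor
  · rintro (⟨z, hz, h⟩ | ⟨z, hz, h⟩)
    · exact ⟨z, hz, Or.inl h⟩
    · exact ⟨z, hz, Or.inr h⟩
  · rintro ⟨z, hz, h | h⟩
    · exact Or.inl ⟨z, hz, h⟩
    · exact Or.inr ⟨z, hz, h⟩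

/-- `indexSet Z ⊆ [0, n]` when the pairs lie in `[0, n]²`. [cite: DuminilCopinHammond2013, proof of Prop. 3.2, Case 2] -/
theorem indexSet_subset_range {Z : Finset (ℕ × ℕ)} (hZ : Z ⊆ range (n + 1) ×ˢ range (n + 1)) :
    indexSet Z ⊆ range (n + 1) := by
  intro x hx
  obtain ⟨z, hz, h | h⟩ := mem_indexSet.1 hx
  · rw [← h]; exact (mem_product.1 (hZ hz)).1
  · rw [← h]; exact (mem_product.1 (hZ hz)).2

/-- For disjoint non-degenerate pairs, `#indexSet Z = 2 #Z`. [cite: DuminilCopinHammond2013, proof of Prop. 3.2, Case 2] -/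
theorem card_indexSet {Z : Finset (ℕ × ℕ)} (hadm : ZigzagAdmissible Z) (hnd : ∀ z ∈ Z, z.1 < z.2) :
    #(indexSet Z) = 2 * #Z := by
  classical
  have hfst : Set.InjOn Prod.fst (Z : Set (ℕ × ℕ)) := fun z hz z' hz' h => by
    by_contra hne
    have := hnd z hz; have := hnd z' hz'
    have h' : z.1 = z'.1 := h
    rcases hadm.2 z hz z' hz' hne with h1 | h1 <;> omega
  have hsnd : Set.InjOn Prod.snd (Z : Set (ℕ × ℕ)) := fun z hz z' hz' h => by
    by_contra hne
    have := hadm.1 z hz; have := hadm.1 z' hz'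
    have h' : z.2 = z'.2 := h
    rcases hadm.2 z hz z' hz' hne with h1 | h1 <;> omega
  have hdisj : Disjoint (Z.image Prod.fst) (Z.image Prod.snd) := by
    rw [Finset.disjoint_left]
    intro k hk1 hk2
    obtain ⟨z, hz, rfl⟩ := mem_image.1 hk1
    obtain ⟨z', hz', h'⟩ := mem_image.1 hk2
    have h'' : z'.2 = z.1 := h'
    have := hnd z hz; have := hnd z' hz'
    rcases eq_or_ne z z' with rfl | hne
    · omega
    · rcases hadm.2 z hz z' hz' hne with h1 | h1 <;> omega
  rw [indexSet, card_union_of_disjoint hdisj, card_image_of_injOn hfst, card_image_of_injOn hsnd]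
  ring

/-- `#indexSet Z ≤ 2 #Z` for any family of pairs. [cite: DuminilCopinHammond2013, proof of Prop. 3.2, Case 2] -/
theorem card_indexSet_le (Z : Finset (ℕ × ℕ)) : #(indexSet Z) ≤ 2 * #Z := by
  classical
  calc #(indexSet Z) ≤ #(Z.image Prod.fst) + #(Z.image Prod.snd) := card_union_le _ _
    _ ≤ #Z + #Z := Nat.add_le_add card_image_le card_image_le
    _ = 2 * #Z := by ring

/-- The least endpoint of a family of disjoint non-degenerate pairs is a point of zig, and its partner is
the next endpoint. [cite: DuminilCopinHammond2013, proof of Prop. 3.2, Case 2] -/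
theorem exists_mem_of_min_indexSet {Z : Finset (ℕ × ℕ)} (hadm : ZigzagAdmissible Z)
    (hnd : ∀ z ∈ Z, z.1 < z.2) {m : ℕ} (hm : m ∈ indexSet Z) (hmin : ∀ x ∈ indexSet Z, m ≤ x) :
    ∃ j, (m, j) ∈ Z ∧ ∀ x ∈ indexSet Z, x ≠ m → j ≤ x := by
  obtain ⟨z, hz, h | h⟩ := mem_indexSet.1 hm
  · have hzm : z = (m, z.2) := Prod.ext h rfl
    refine ⟨z.2, hzm ▸ hz, fun x hx hxm => ?_⟩
    have hz12 := hnd z hz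
    obtain ⟨z', hz', h' | h'⟩ := mem_indexSet.1 hx
    · rcases eq_or_ne z z' with heq | hne
      · subst heq; omega
      · have h1 := hmin z'.1 (mem_indexSet.2 ⟨z', hz', Or.inl rfl⟩)
        have := hnd z' hz'
        rcases hadm.2 z hz z' hz' hne with h2 | h2 <;> omega
    · rcases eq_or_ne z z' with heq | hne
      · subst heq; omega
      · have h1 := hmin z'.1 (mem_indexSet.2 ⟨z', hz', Or.inl rfl⟩)
        have := hnd z' hz'
        rcases hadm.2 z hz z' hz' hne with h2 | h2 <;> omega
  · -- `m` a point of zag is impossible: its point of zig would be smaller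
    have h1 := hmin z.1 (mem_indexSet.2 ⟨z, hz, Or.inl rfl⟩)
    have := hnd z hz
    omega

/-- Removing a pair removes exactly its two endpoints from the index set (disjoint non-degenerate pairs).
[cite: DuminilCopinHammond2013, proof of Prop. 3.2, Case 2] -/
theorem indexSet_erase {Z : Finset (ℕ × ℕ)} (hadm : ZigzagAdmissible Z) (hnd : ∀ z ∈ Z, z.1 < z.2)
    {z : ℕ × ℕ} (hz : z ∈ Z) : indexSet (Z.erase z) = ((indexSet Z).erase z.1).erase z.2 := by
  classical
  ext x
  rw [mem_indexSet, mem_erase, mem_erase, mem_indexSet]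
  constructor
  · rintro ⟨z', hz', h⟩
    rw [mem_erase] at hz'
    have hne := hz'.1
    have := hnd z hz; have := hnd z' hz'.2
    have hd := hadm.2 z hz z' hz'.2 (Ne.symm hne)
    refine ⟨?_, ?_, z', hz'.2, h⟩ <;> rcases h with h | h <;> rcases hd with hd | hd <;> omega
  · rintro ⟨hx2, hx1, z', hz', h⟩
    refine ⟨z', mem_erase.2 ⟨?_, hz'⟩, h⟩
    rintro rfl
    rcases h with h | h
    · exact hx1 h.symm
    · exact hx2 h.symm

/-- **A family of disjoint non-degenerate pairs is determined by its index set** (pair the endpoints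
consecutively). [cite: DuminilCopinHammond2013, proof of Prop. 3.2, Case 2 (arXiv v1, pp. 14–15)] -/
theorem eq_of_indexSet_eq : ∀ (k : ℕ) {Z Z' : Finset (ℕ × ℕ)}, #Z = k → ZigzagAdmissible Z →
    (∀ z ∈ Z, z.1 < z.2) → ZigzagAdmissible Z' → (∀ z ∈ Z', z.1 < z.2) → indexSet Z = indexSet Z' → Z = Z' := by
  classical
  intro k
  induction k with
  | zero =>
    intro Z Z' hk hadm hnd hadm' hnd' hI
    have hZ : Z = ∅ := card_eq_zero.1 hk
    subst hZ
    have hI' : indexSet Z' = ∅ := by rw [← hI]; simp [indexSet]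
    symm
    by_contra hne
    obtain ⟨z, hz⟩ := Finset.nonempty_iff_ne_empty.2 hne
    have : z.1 ∈ indexSet Z' := mem_indexSet.2 ⟨z, hz, Or.inl rfl⟩
    rw [hI'] at this
    exact absurd this (Finset.notMem_empty _)
  | succ k ih =>
    intro Z Z' hk hadm hnd hadm' hnd' hI
    have hZne : Z.Nonempty := card_pos.1 (by omega)
    obtain ⟨z₀, hz₀⟩ := hZne
    have hIne : (indexSet Z).Nonempty := ⟨z₀.1, mem_indexSet.2 ⟨z₀, hz₀, Or.inl rfl⟩⟩
    set m := (indexSet Z).min' hIne with hmdef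
    have hm : m ∈ indexSet Z := Finset.min'_mem _ _
    have hmin : ∀ x ∈ indexSet Z, m ≤ x := fun x hx => Finset.min'_le _ _ hx
    obtain ⟨j, hj, hjmin⟩ := exists_mem_of_min_indexSet hadm hnd hm hmin
    have hm' : m ∈ indexSet Z' := hI ▸ hm
    have hmin' : ∀ x ∈ indexSet Z', m ≤ x := fun x hx => hmin x (hI ▸ hx)
    obtain ⟨j', hj', hjmin'⟩ := exists_mem_of_min_indexSet hadm' hnd' hm' hmin'
    have hmj : m < j := hnd (m, j) hj
    have hmj' : m < j' := hnd' (m, j') hj'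
    have hjj' : j = j' := by
      have h1 : j ≤ j' := hjmin j' (hI ▸ mem_indexSet.2 ⟨(m, j'), hj', Or.inr rfl⟩) (by omega)
      have h2 : j' ≤ j := hjmin' j (hI ▸ mem_indexSet.2 ⟨(m, j), hj, Or.inr rfl⟩) (by omega)
      omega
    subst hjj'
    have hE : Z.erase (m, j) = Z'.erase (m, j) :=
      ih (by rw [card_erase_of_mem hj, hk]; rfl) (hadm.mono (erase_subset _ _))
        (fun z hz => hnd z (mem_of_mem_erase hz)) (hadm'.mono (erase_subset _ _))
        (fun z hz => hnd' z (mem_of_mem_erase hz))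
        (by rw [indexSet_erase hadm hnd hj, indexSet_erase hadm' hnd' hj', hI])
    rw [← insert_erase hj, ← insert_erase hj', hE]

/-- Degenerate pairs do not move the walk: `Unf_Z = Unf_{Z ∩ {i<j}}`.
[cite: DuminilCopinHammond2013, Definition 3.6 / proof of Prop. 3.2, Case 2] -/
theorem unfoldZigzags_filter_lt {Z : Finset (ℕ × ℕ)} (hZ : ∀ z ∈ Z, z.1 ≤ z.2) (ω : ℕ → Site d) :
    unfoldZigzags (Z.filter fun z => z.1 < z.2) ω = unfoldZigzags Z ω := by
  classical
  refine walk_ext (fun k => ?_) (fun k c hc => by simp [hc])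
  rw [unfoldZigzags_apply_zero, unfoldZigzags_apply_zero, zigzagsShift, zigzagsShift, sum_filter]
  congr 1
  refine sum_congr rfl fun z hz => ?_
  by_cases h : z.1 < z.2
  · rw [if_pos h]
  · rw [if_neg h]
    obtain ⟨a, b⟩ := z
    have hab : a = b := by have := hZ (a, b) hz; simp only at this h ⊢; omega
    subst hab
    simp

/-- **Case 2 reconstruction by the index set**: on each fibre of `γ ↦ Unf_{Z(γ)}(γ)`, the map
`γ ↦` (index set of the non-degenerate zigzags of `γ`) is injective.
[cite: DuminilCopinHammond2013, proof of Prop. 3.2, Case 2, display (3.5) (arXiv v1, pp. 14–15)] -/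
theorem injOn_indexSet_of_unfoldZigzags_eq (n : ℕ) (φ : ℕ → Site d) :
    Set.InjOn (fun γ : ℕ → Site d => indexSet ((zigzags n γ).filter fun z => z.1 < z.2))
      {γ | unfoldZigzags (zigzags n γ) γ = φ} := by
  intro γ hγ γ' hγ' h
  simp only [Set.mem_setOf_eq] at hγ hγ' h
  have hadm : ZigzagAdmissible ((zigzags n γ).filter fun z => z.1 < z.2) :=
    zigzagAdmissible_of_subset (filter_subset _ _)
  have hadm' : ZigzagAdmissible ((zigzags n γ').filter fun z => z.1 < z.2) :=
    zigzagAdmissible_of_subset (filter_subset _ _)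
  have hE := eq_of_indexSet_eq _ rfl hadm (fun z hz => (mem_filter.1 hz).2) hadm'
    (fun z hz => (mem_filter.1 hz).2) h
  have e1 : unfoldZigzags ((zigzags n γ).filter fun z => z.1 < z.2) γ = φ := by
    rw [unfoldZigzags_filter_lt (fun z hz => (mem_zigzags.1 hz).le)]; exact hγ
  have e2 : unfoldZigzags ((zigzags n γ').filter fun z => z.1 < z.2) γ' = φ := by
    rw [unfoldZigzags_filter_lt (fun z hz => (mem_zigzags.1 hz).le)]; exact hγ'
  have h1 := unfoldZigzags_unfoldZigzags (ω := γ) hadm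
  have h2 := unfoldZigzags_unfoldZigzags (ω := γ') hadm'
  rw [e1] at h1
  rw [e2] at h2
  rw [← h1, hE, h2]

/-- **Case 2 preimage bound by index sets**: a family `S` of walks, each with at most `m` NON-DEGENERATE
zigzags and all unfolding (all zigzags at once) to the same `φ`, has at most as many members as there
are subsets of `[0, n]` with at most `2m` elements.
[cite: DuminilCopinHammond2013, proof of Prop. 3.2, Case 2, display (3.5): "≤ binom(u_n, 2ε_n u_n)" (arXiv v1, p. 14)] -/
theorem card_le_of_unfoldZigzags_all_eq_indexSet (n : ℕ) (φ : ℕ → Site d) (m : ℕ)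
    {S : Finset (ℕ → Site d)}
    (hS : ∀ γ ∈ S, #((zigzags n γ).filter fun z => z.1 < z.2) ≤ m ∧ unfoldZigzags (zigzags n γ) γ = φ) :
    #S ≤ #(((range (n + 1)).powerset).filter fun I => #I ≤ 2 * m) := by
  refine card_le_card_of_injOn (t := ((range (n + 1)).powerset).filter fun I => #I ≤ 2 * m)
    (fun γ => indexSet ((zigzags n γ).filter fun z => z.1 < z.2)) (fun γ hγ => ?_)
    fun γ hγ γ' hγ' h => ?_
  · have h1 := (hS γ (Finset.mem_coe.1 hγ)).1
    refine Finset.mem_coe.2 (mem_filter.2 ⟨mem_powerset.2 (indexSet_subset_range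
      ((filter_subset _ _).trans (zigzags_subset_product n γ))), ?_⟩)
    exact (card_indexSet_le _).trans (by omega)
  · exact injOn_indexSet_of_unfoldZigzags_eq n φ (hS γ (Finset.mem_coe.1 hγ)).2
      (hS γ' (Finset.mem_coe.1 hγ')).2 h

/-- Counting the code words: `#{I ⊆ s : |I| ≤ t} = Σ_{j ≤ t} binom(|s|, j)`.
[cite: DuminilCopinHammond2013, proof of Prop. 3.2, Case 2 (arXiv v1, pp. 14–15)] -/
theorem card_powerset_filter_card_le (s : Finset ℕ) (t : ℕ) :
    #((s.powerset).filter fun I => #I ≤ t) = ∑ j ∈ range (t + 1), (#s).choose j := by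
  classical
  have hset : (s.powerset).filter (fun I => #I ≤ t) = (range (t + 1)).biUnion fun j => s.powersetCard j := by
    ext I
    simp only [mem_filter, mem_powerset, mem_biUnion, mem_range, mem_powersetCard]
    constructor
    · rintro ⟨h1, h2⟩; exact ⟨#I, by omega, h1, rfl⟩
    · rintro ⟨j, hj, h1, h2⟩; exact ⟨h1, by omega⟩
  rw [hset, card_biUnion]
  · exact sum_congr rfl fun j _ => card_powersetCard _ _
  · intro j _ j' _ hne
    rw [Function.onFun, Finset.disjoint_left]
    intro I hI hI'
    rw [mem_powersetCard] at hI hI'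
    exact hne (hI.2.symm.trans hI'.2)

end IndexSet

end Literature.Probability.RandomPlanarGeometry.SAW.Zd

end
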